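import Literature.Analysis.PDE.ParabolicJetsLocalCompactness
import Literature.Analysis.PDE.ParabolicJetsLocalBounds
import Literature.Analysis.PDE.HeatLiouvilleHolder
import Literature.Analysis.PDE.ParabolicJetsRescaling
import HarnessLib

/-!
# The global parabolic Schauder seminorm estimate by blow-up

Topic `Literature/Analysis/PDE`.  L. Simon's blow-up proof of the (global, scale-invariant core
of the) interior Schauder estimate for the heat operator (White 2005, Thm. 8.2, in the parabolic
`C^{2,α}` vocabulary of `ParabolicHolderNorm.lean`).  Main result `nnHolderNorm_jets_le_heat`:
for `0 < α < 1` there is `C` with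
`‖D² u‖_{C^{0,α}} + ‖∂ₜ u‖_{C^{0,α}} ≤ C ‖∂ₜ u - tr D² u‖_{C^{0,α}}` for every `u : R^m × ℝ → F`
satisfying the regularity guard everywhere with `D² u`, `∂ₜ u` globally `α`-Hölder.  It is
reduced (`exists_normalized_of_lt`: near-optimal pair for the seminorm, recentring, parabolic
dilation, rescaling and Taylor normalization, `ParabolicJetsRescaling.lean`) to the core
contradiction `blowUp_core`: **there is no sequence** `wₖ : R^m × ℝ → F`
(regularity guard everywhere) normalized by `wₖ(0) = 0`, `D wₖ(0) = 0`, `D² wₖ(0) = 0`,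
`∂ₜ wₖ(0) = 0`, with `D² wₖ`, `∂ₜ wₖ` uniformly `α`-Hölder (constant `1`, `0 < α < 1`), heat
operators `‖(∂ₜ wₖ - tr D² wₖ)(Z)‖ ≤ εₖ d(Z, 0)^α` with `εₖ → 0`, and
`max(‖D² wₖ(ξₖ)‖, ‖∂ₜ wₖ(ξₖ)‖) ≥ ¼` at points `ξₖ` of the unit parabolic sphere
(`blowUp_core`).  Proof: extract `ξₖ → ξ₀`; the normalized jets are locally uniformly bounded
and equicontinuous (`jets_bound_of_normalized`, `jets_modulus_of_normalized`, from
`ParabolicJetsLocalBounds.lean`); diagonal Arzelà–Ascoli and identification of the limits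
(`ParabolicJetsLocalCompactness.lean`) give a limit `v` with `D² v`, `∂ₜ v` `α`-Hölder, solving the
heat equation, vanishing at `0` and of size `≥ ¼` at `ξ₀`; but by the Liouville theorem
`hessian_const_of_heat_of_holder` (`HeatLiouvilleHolder.lean`, after transfer to the time-first
line-derivative vocabulary: `jets_const_of_heat_limit`) `D² v` and `∂ₜ v` are constant —
contradiction.

Section `Local`: the same contradiction on EXPANDING domains (`blowUp_core_local`: regularity,
Hölder bounds and approximate heat equation only on `B(0, Rₖ)`, `Rₖ → ∞`), and its application
`jets_holder_eventually_le_of_heat` — White's use of the Schauder estimate on pp. 1499, 1505: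
`C²`-convergence to `0` + uniform `C^{2,α}` bounds + `L uᵢ → 0` in `C^α` give `C^{2,α}`-convergence
to `0` on smaller balls (no cutoffs, interpolation or absorption needed).

Everything is PROVED; no definitions, no named facts.

## References

* [White2005] B. White, *A local regularity theorem for mean curvature flow*, Ann. of Math. 161
  (2005), Thm. 8.2 (the interior Schauder estimate this serves) and the blow-up scheme of §3.
* L. Simon, *Schauder estimates by scaling*, Calc. Var. PDE 5 (1997) 391–407 (the method; not
  held — the argument here is self-contained).
-/

noncomputable section

open Set Filter Metric Topology Function
open scoped NNReal

namespace Literature.Analysis.PDE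

open Parabolic

variable {m : ℕ}
variable {F : Type*} [NormedAddCommGroup F] [InnerProductSpace ℝ F] [FiniteDimensional ℝ F]

/-- `d^α ≤ 1 + d` for `d ≥ 0`, `0 ≤ α ≤ 1`. [folklore] -/
theorem rpow_le_one_add {d a : ℝ} (hd : 0 ≤ d) (ha0 : 0 ≤ a) (ha1 : a ≤ 1) :
    d ^ a ≤ 1 + d := by
  rcases le_or_gt d 1 with h | h
  · exact (Real.rpow_le_one hd h ha0).trans (by linarith)
  · exact (Real.rpow_le_self_of_one_le h.le ha1).trans (by linarith)

/-- A `HolderWith 1 α` function vanishing at `0` is bounded by `1 + d(Z, 0)` (for `α ≤ 1`).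
[folklore] -/
theorem norm_le_one_add_dist_of_holderWith {Y : Type*} [NormedAddCommGroup Y] {α : ℝ≥0}
    (hα1 : α ≤ 1) {f : Parabolic (EuclideanSpace ℝ (Fin m)) → Y} (hf : HolderWith 1 α f)
    (hf0 : f 0 = 0) (Z : Parabolic (EuclideanSpace ℝ (Fin m))) : ‖f Z‖ ≤ 1 + dist Z 0 := by
  have h := hf.dist_le_of_le (x := Z) (y := 0) le_rfl
  rw [hf0, _root_.dist_zero_right, NNReal.coe_one, one_mul] at h
  exact h.trans (rpow_le_one_add dist_nonneg α.2 hα1)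

/-- **Liouville for the blow-up limit** (transfer to `ℝ × E` and `hessian_const_of_heat_of_holder`):
if `v` satisfies the guard everywhere with continuous jets `D v = V`, `D² v = V2`, `∂ₜ v = Zt`,
`V2` and `Zt` are `α`-Hölder with constant `1` (`α < 1`) and `Zt = tr V2` (heat equation), then
`V2` and `Zt` are constant. [folklore] -/
theorem jets_const_of_heat_limit {α : ℝ≥0} (hα1 : α < 1)
    {v : Parabolic (EuclideanSpace ℝ (Fin m)) → F} (hvC : IsC21On v univ) (hvc : Continuous v)
    {V : Parabolic (EuclideanSpace ℝ (Fin m)) → (EuclideanSpace ℝ (Fin m) →L[ℝ] F)}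
    {V2 : Parabolic (EuclideanSpace ℝ (Fin m)) →
      (EuclideanSpace ℝ (Fin m) →L[ℝ] EuclideanSpace ℝ (Fin m) →L[ℝ] F)}
    {Zt : Parabolic (EuclideanSpace ℝ (Fin m)) → F}
    (hVc : Continuous V) (hV2c : Continuous V2) (hZtc : Continuous Zt)
    (hsd : ∀ X, spaceDeriv v X = V X) (hsd2 : ∀ X, spaceDeriv (spaceDeriv v) X = V2 X)
    (htd : ∀ X, timeDeriv v X = Zt X)
    (hV2H : ∀ X Y, ‖V2 X - V2 Y‖ ≤ dist X Y ^ (α : ℝ))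
    (hZtH : ∀ X Y, ‖Zt X - Zt Y‖ ≤ dist X Y ^ (α : ℝ))
    (hheat : ∀ X, Zt X = ∑ i, V2 X (stdOrthonormalBasis ℝ (EuclideanSpace ℝ (Fin m)) i)
      (stdOrthonormalBasis ℝ (EuclideanSpace ℝ (Fin m)) i)) :
    (∀ X, V2 X = V2 0) ∧ (∀ X, Zt X = Zt 0) := by
  have hemb : Continuous fun z : ℝ × EuclideanSpace ℝ (Fin m) =>
      (⟨z.2, z.1⟩ : Parabolic (EuclideanSpace ℝ (Fin m))) :=
    (homeomorphProd (E := EuclideanSpace ℝ (Fin m))).symm.continuous.comp continuous_swap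
  have hVfun : ∀ t : ℝ, (fun x' : EuclideanSpace ℝ (Fin m) => spaceDeriv v ⟨x', t⟩) =
      fun x' => V ⟨x', t⟩ := fun t => funext fun x' => hsd _
  -- the parabolic distance of swapped pairs is at most the gauge `‖x - y‖ + √|t - s|`
  have hdist : ∀ z y : ℝ × EuclideanSpace ℝ (Fin m),
      dist (⟨z.2, z.1⟩ : Parabolic (EuclideanSpace ℝ (Fin m))) ⟨y.2, y.1⟩ ≤
        ‖z.2 - y.2‖ + Real.sqrt |z.1 - y.1| := by
    intro z y
    rw [dist_eq]
    refine max_le ?_ ?_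
    · rw [dist_eq_norm]; linarith [Real.sqrt_nonneg |z.1 - y.1|]
    · rw [Real.dist_eq]; linarith [norm_nonneg (z.2 - y.2)]
  have key := hessian_const_of_heat_of_holder (E := EuclideanSpace ℝ (Fin m)) (F := F)
    (u := fun z => v ⟨z.2, z.1⟩) (ut := fun z => Zt ⟨z.2, z.1⟩) (D := fun z => V ⟨z.2, z.1⟩)
    (D2 := fun z => V2 ⟨z.2, z.1⟩) (A := 1) (α := (α : ℝ)) α.2 (NNReal.coe_lt_one.2 hα1)
    (hvc.comp hemb) (hZtc.comp hemb) (hVc.comp hemb) (hV2c.comp hemb)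
    (fun z => ?_) (fun z e => ?_) (fun z e e' => ?_) (fun z => hheat _)
    (fun z y => by
      rw [one_mul]; exact (hZtH _ _).trans (Real.rpow_le_rpow dist_nonneg (hdist z y) α.2))
    (fun z y => by
      rw [one_mul]; exact (hV2H _ _).trans (Real.rpow_le_rpow dist_nonneg (hdist z y) α.2))
  · have e0 : (⟨(0 : EuclideanSpace ℝ (Fin m)), (0 : ℝ)⟩ : Parabolic (EuclideanSpace ℝ (Fin m))) =
        0 := rfl
    refine ⟨fun X => ?_, fun X => ?_⟩
    · obtain ⟨x, t⟩ := X
      simpa [e0] using key.1 (t, x)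
    · obtain ⟨x, t⟩ := X
      simpa [e0] using key.2 (t, x)
  · -- time line derivative
    show HasDerivAt (fun s : ℝ => v ⟨(z + s • ((1 : ℝ), (0 : EuclideanSpace ℝ (Fin m)))).2,
      (z + s • ((1 : ℝ), (0 : EuclideanSpace ℝ (Fin m)))).1⟩) (Zt ⟨z.2, z.1⟩) 0
    have hfun : (fun s : ℝ => v ⟨(z + s • ((1 : ℝ), (0 : EuclideanSpace ℝ (Fin m)))).2,
        (z + s • ((1 : ℝ), (0 : EuclideanSpace ℝ (Fin m)))).1⟩) = fun s => v ⟨z.2, z.1 + s⟩ := by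
      funext s; simp
    rw [hfun]
    have h := hvC.hasDerivAt_time (x := z.2) (t := z.1 + 0) (mem_univ _)
    rw [htd] at h
    simpa using h.comp_const_add z.1 0
  · -- spatial line derivative
    show HasDerivAt (fun s : ℝ => v ⟨(z + s • ((0 : ℝ), e)).2, (z + s • ((0 : ℝ), e)).1⟩)
      (V ⟨z.2, z.1⟩ e) 0
    have hfun : (fun s : ℝ => v ⟨(z + s • ((0 : ℝ), e)).2, (z + s • ((0 : ℝ), e)).1⟩) =
        fun s => v ⟨z.2 + s • e, z.1⟩ := by
      funext s; simp
    rw [hfun]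
    have hl : HasDerivAt (fun s : ℝ => z.2 + s • e) e 0 := by
      simpa using ((hasDerivAt_id (0 : ℝ)).smul_const e).const_add z.2
    have h : HasFDerivAt (fun x' => v ⟨x', z.1⟩) (V ⟨z.2 + (0 : ℝ) • e, z.1⟩)
        (z.2 + (0 : ℝ) • e) := by
      rw [← hsd]; exact hvC.hasFDerivAt_space (mem_univ _)
    simpa [Function.comp_def] using h.comp_hasDerivAt (0 : ℝ) hl
  · -- second spatial line derivative
    show HasDerivAt (fun s : ℝ => V ⟨(z + s • ((0 : ℝ), e)).2, (z + s • ((0 : ℝ), e)).1⟩ e')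
      (V2 ⟨z.2, z.1⟩ e e') 0
    have hfun : (fun s : ℝ => V ⟨(z + s • ((0 : ℝ), e)).2, (z + s • ((0 : ℝ), e)).1⟩ e') =
        fun s => V ⟨z.2 + s • e, z.1⟩ e' := by
      funext s; simp
    rw [hfun]
    have hl : HasDerivAt (fun s : ℝ => z.2 + s • e) e 0 := by
      simpa using ((hasDerivAt_id (0 : ℝ)).smul_const e).const_add z.2
    have h : HasFDerivAt (fun x' => V ⟨x', z.1⟩) (V2 ⟨z.2 + (0 : ℝ) • e, z.1⟩)
        (z.2 + (0 : ℝ) • e) := by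
      rw [← hVfun, ← hsd2]; exact hvC.hasFDerivAt_spaceDeriv (mem_univ _)
    have h1 : HasDerivAt (fun s : ℝ => V ⟨z.2 + s • e, z.1⟩) (V2 ⟨z.2 + (0 : ℝ) • e, z.1⟩ e) 0 := by
      simpa [Function.comp_def] using h.comp_hasDerivAt (0 : ℝ) hl
    simpa using h1.clm_apply (hasDerivAt_const (0 : ℝ) e')

/-- `d < δ^{1/α}` gives `d^α ≤ δ`. [folklore] -/
theorem rpow_le_of_lt_rpow_inv {δ d : ℝ} (hδ : 0 < δ) {α : ℝ≥0} (hα0 : 0 < α) (hd : 0 ≤ d)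
    (hlt : d < δ ^ ((α : ℝ)⁻¹)) : d ^ (α : ℝ) ≤ δ := by
  have hα' : (α : ℝ) ≠ 0 := (NNReal.coe_pos.2 hα0).ne'
  have h1 : d ^ (α : ℝ) ≤ (δ ^ ((α : ℝ)⁻¹)) ^ (α : ℝ) :=
    Real.rpow_le_rpow hd hlt.le (NNReal.coe_nonneg α)
  rwa [Real.rpow_inv_rpow hδ.le hα'] at h1

/-- Polynomial bookkeeping: the constants of `ParabolicJetsLocalBounds` at `R = n + 1`,
`M₁ = M₂ = 1 + 3R`, are below `100 R³`. [folklore] -/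
theorem constants_le_hundred_cube (n : ℕ) :
    0 < (n : ℝ) + 1 ∧
    (3 * (1 + 3 * ((n : ℝ) + 1)) + 3 * (1 + 3 * ((n : ℝ) + 1))) * ((n : ℝ) + 1) * ((n : ℝ) + 1) ≤
      100 * ((n : ℝ) + 1) ^ 3 ∧
    (1 + 3 * ((n : ℝ) + 1) + 3 * (1 + 3 * ((n : ℝ) + 1))) * ((n : ℝ) + 1) ≤
      100 * ((n : ℝ) + 1) ^ 3 ∧
    1 + 3 * ((n : ℝ) + 1) ≤ 100 * ((n : ℝ) + 1) ^ 3 ∧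
    (3 * (1 + 3 * ((n : ℝ) + 1)) + 3 * (1 + 3 * ((n : ℝ) + 1))) * ((n : ℝ) + 1) ≤
      100 * ((n : ℝ) + 1) ^ 3 ∧
    1 + 3 * ((n : ℝ) + 1) + 3 * (1 + 3 * ((n : ℝ) + 1)) ≤ 100 * ((n : ℝ) + 1) ^ 3 := by
  have hn : (0 : ℝ) ≤ n := Nat.cast_nonneg n
  set R : ℝ := (n : ℝ) + 1 with hR
  have hR1 : 1 ≤ R := by rw [hR]; linarith
  have hRR : R ≤ R ^ 2 := by nlinarith
  have hRRR : R ^ 2 ≤ R ^ 3 := by nlinarith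
  refine ⟨by positivity, ?_, ?_, ?_, ?_, ?_⟩ <;> nlinarith

omit [FiniteDimensional ℝ F] in
/-- **Uniform local bounds for a normalized jet**: from the guard, `w(0) = 0`, `D w(0) = 0`,
`D² w(0) = 0`, `∂ₜ w(0) = 0` and `HolderWith 1 α` bounds on `D² w`, `∂ₜ w` (`α ≤ 1`), the jets are
bounded by `100 (n+1)³` on `B(0, n+1)`. [folklore] -/
theorem jets_bound_of_normalized {α : ℝ≥0} (hα1 : α ≤ 1)
    {w : Parabolic (EuclideanSpace ℝ (Fin m)) → F} (hC : IsC21On w univ)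
    (hD2 : HolderWith 1 α (spaceDeriv (spaceDeriv w))) (hT : HolderWith 1 α (timeDeriv w))
    (h0 : w 0 = 0) (h1 : spaceDeriv w 0 = 0) (h2 : spaceDeriv (spaceDeriv w) 0 = 0)
    (h3 : timeDeriv w 0 = 0) (n : ℕ) {X : Parabolic (EuclideanSpace ℝ (Fin m))}
    (hX : X ∈ ball (0 : Parabolic (EuclideanSpace ℝ (Fin m))) ((n : ℝ) + 1)) :
    ‖w X‖ ≤ 100 * ((n : ℝ) + 1) ^ 3 ∧ ‖spaceDeriv w X‖ ≤ 100 * ((n : ℝ) + 1) ^ 3 ∧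
      ‖spaceDeriv (spaceDeriv w) X‖ ≤ 100 * ((n : ℝ) + 1) ^ 3 ∧
        ‖timeDeriv w X‖ ≤ 100 * ((n : ℝ) + 1) ^ 3 := by
  obtain ⟨hR0, hp1, hp2, hp3, -, -⟩ := constants_le_hundred_cube n
  have hM₁ : ∀ Z ∈ ball (0 : Parabolic (EuclideanSpace ℝ (Fin m))) (3 * ((n : ℝ) + 1)),
      ‖timeDeriv w Z‖ ≤ 1 + 3 * ((n : ℝ) + 1) := fun Z hZ =>
    (norm_le_one_add_dist_of_holderWith hα1 hT h3 Z).trans (by linarith [mem_ball.1 hZ])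
  have hM₂ : ∀ Z ∈ ball (0 : Parabolic (EuclideanSpace ℝ (Fin m))) (3 * ((n : ℝ) + 1)),
      ‖spaceDeriv (spaceDeriv w) Z‖ ≤ 1 + 3 * ((n : ℝ) + 1) := fun Z hZ =>
    (norm_le_one_add_dist_of_holderWith hα1 hD2 h2 Z).trans (by linarith [mem_ball.1 hZ])
  have hX3 : X ∈ ball (0 : Parabolic (EuclideanSpace ℝ (Fin m))) (3 * ((n : ℝ) + 1)) :=
    ball_subset_ball (by linarith) hX
  exact ⟨(norm_le_of_bounds hC h0 h1 hR0 hM₁ hM₂ hX).trans hp1,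
    (norm_spaceDeriv_le_of_bounds hC h1 hR0 hM₁ hM₂ hX).trans hp2, (hM₂ X hX3).trans hp3,
    (hM₁ X hX3).trans hp3⟩

omit [FiniteDimensional ℝ F] in
/-- **Uniform local moduli for a normalized jet**: under the hypotheses of
`jets_bound_of_normalized` (and `0 < α`), on `B(0, n+1)` all four jets vary by at most `δ` on
pairs at parabolic distance `< min(δ^{1/α}, δ/(100 (n+1)³))`. [folklore] -/
theorem jets_modulus_of_normalized {α : ℝ≥0} (hα0 : 0 < α) (hα1 : α ≤ 1)
    {w : Parabolic (EuclideanSpace ℝ (Fin m)) → F} (hC : IsC21On w univ)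
    (hD2 : HolderWith 1 α (spaceDeriv (spaceDeriv w))) (hT : HolderWith 1 α (timeDeriv w))
    (h1 : spaceDeriv w 0 = 0) (h2 : spaceDeriv (spaceDeriv w) 0 = 0)
    (h3 : timeDeriv w 0 = 0) (n : ℕ) {δ : ℝ} (hδ : 0 < δ)
    {X Y : Parabolic (EuclideanSpace ℝ (Fin m))}
    (hX : X ∈ ball (0 : Parabolic (EuclideanSpace ℝ (Fin m))) ((n : ℝ) + 1))
    (hY : Y ∈ ball (0 : Parabolic (EuclideanSpace ℝ (Fin m))) ((n : ℝ) + 1))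
    (hXY : dist X Y < min (δ ^ ((α : ℝ)⁻¹)) (δ / (100 * ((n : ℝ) + 1) ^ 3))) :
    ‖w X - w Y‖ ≤ δ ∧ ‖spaceDeriv w X - spaceDeriv w Y‖ ≤ δ ∧
      ‖spaceDeriv (spaceDeriv w) X - spaceDeriv (spaceDeriv w) Y‖ ≤ δ ∧
        ‖timeDeriv w X - timeDeriv w Y‖ ≤ δ := by
  obtain ⟨hR0, -, -, -, hp4, hp5⟩ := constants_le_hundred_cube n
  have hM₁ : ∀ Z ∈ ball (0 : Parabolic (EuclideanSpace ℝ (Fin m))) (3 * ((n : ℝ) + 1)),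
      ‖timeDeriv w Z‖ ≤ 1 + 3 * ((n : ℝ) + 1) := fun Z hZ =>
    (norm_le_one_add_dist_of_holderWith hα1 hT h3 Z).trans (by linarith [mem_ball.1 hZ])
  have hM₂ : ∀ Z ∈ ball (0 : Parabolic (EuclideanSpace ℝ (Fin m))) (3 * ((n : ℝ) + 1)),
      ‖spaceDeriv (spaceDeriv w) Z‖ ≤ 1 + 3 * ((n : ℝ) + 1) := fun Z hZ =>
    (norm_le_one_add_dist_of_holderWith hα1 hD2 h2 Z).trans (by linarith [mem_ball.1 hZ])
  have hXY1 : dist X Y < δ ^ ((α : ℝ)⁻¹) := lt_of_lt_of_le hXY (min_le_left _ _)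
  have hXY2 : dist X Y < δ / (100 * ((n : ℝ) + 1) ^ 3) := lt_of_lt_of_le hXY (min_le_right _ _)
  have hdα : dist X Y ^ (α : ℝ) ≤ δ := rpow_le_of_lt_rpow_inv hδ hα0 dist_nonneg hXY1
  have hHol2 : ‖spaceDeriv (spaceDeriv w) X - spaceDeriv (spaceDeriv w) Y‖ ≤ δ := by
    have h := hD2.dist_le_of_le (x := X) (y := Y) le_rfl
    rw [NNReal.coe_one, one_mul, dist_eq_norm] at h
    exact h.trans hdα
  have hHolT : ‖timeDeriv w X - timeDeriv w Y‖ ≤ δ := by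
    have h := hT.dist_le_of_le (x := X) (y := Y) le_rfl
    rw [NNReal.coe_one, one_mul, dist_eq_norm] at h
    exact h.trans hdα
  have hL : 100 * ((n : ℝ) + 1) ^ 3 * dist X Y ≤ δ := by
    rw [lt_div_iff₀ (by positivity)] at hXY2
    linarith
  have hd0 : 0 ≤ dist X Y := dist_nonneg
  exact ⟨(norm_sub_le_of_bounds hC h1 hR0 hM₁ hM₂ hX hY).trans
      ((mul_le_mul_of_nonneg_right hp4 hd0).trans hL),
    (norm_spaceDeriv_sub_le_of_bounds hC hR0 hM₁ hM₂ hX hY).trans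
      ((mul_le_mul_of_nonneg_right hp5 hd0).trans hL), hHol2, hHolT⟩

/-- **The blow-up contradiction.**  There is no sequence `wₖ` of functions on `R^m × ℝ`,
satisfying the regularity guard everywhere, normalized by
`wₖ(0) = 0, D wₖ(0) = 0, D² wₖ(0) = 0, ∂ₜ wₖ(0) = 0`, with `D² wₖ`, `∂ₜ wₖ` uniformly `α`-Hölder
(constant `1`, `0 < α < 1`), heat operators `∂ₜ wₖ - tr D² wₖ` tending to `0` in the weighted sense
`‖·‖ ≤ εₖ d(·, 0)^α`, `εₖ → 0`, and `max(‖D² wₖ (ξₖ)‖, ‖∂ₜ wₖ (ξₖ)‖) ≥ ¼` at points `ξₖ` of the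
unit parabolic sphere.  (Arzelà–Ascoli on all balls, identification of the limits, and the
Liouville theorem for the limit, whose `D²` and `∂ₜ` must be constant, hence vanish at
`ξ = lim ξₖ` as at `0`.) [folklore] -/
theorem blowUp_core {α : ℝ≥0} (hα0 : 0 < α) (hα1 : α < 1)
    (w : ℕ → Parabolic (EuclideanSpace ℝ (Fin m)) → F) (hC : ∀ k, IsC21On (w k) univ)
    (hD2 : ∀ k, HolderWith 1 α (spaceDeriv (spaceDeriv (w k))))
    (hT : ∀ k, HolderWith 1 α (timeDeriv (w k)))
    (h0 : ∀ k, w k 0 = 0) (h1 : ∀ k, spaceDeriv (w k) 0 = 0)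
    (h2 : ∀ k, spaceDeriv (spaceDeriv (w k)) 0 = 0) (h3 : ∀ k, timeDeriv (w k) 0 = 0)
    (ε : ℕ → ℝ) (hε : Tendsto ε atTop (𝓝 0))
    (hH : ∀ k Z, ‖timeDeriv (w k) Z - ∑ i, spaceDeriv (spaceDeriv (w k)) Z
      (stdOrthonormalBasis ℝ (EuclideanSpace ℝ (Fin m)) i)
      (stdOrthonormalBasis ℝ (EuclideanSpace ℝ (Fin m)) i)‖ ≤ ε k * dist Z 0 ^ (α : ℝ))
    (ξ : ℕ → Parabolic (EuclideanSpace ℝ (Fin m))) (hξ : ∀ k, dist (ξ k) 0 = 1)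
    (hbig : ∀ k, (1 / 4 : ℝ) ≤
      max ‖spaceDeriv (spaceDeriv (w k)) (ξ k)‖ ‖timeDeriv (w k) (ξ k)‖) : False := by
  set b := stdOrthonormalBasis ℝ (EuclideanSpace ℝ (Fin m)) with hb
  -- Step 1: a subsequence along which `ξₖ → ξ₀`, `d(ξ₀, 0) = 1`
  obtain ⟨ξ₀, -, ψ, hψ, hξlim⟩ := (isCompact_closedBall (0 : Parabolic (EuclideanSpace ℝ
    (Fin m))) 1).tendsto_subseq (x := ξ) fun k => mem_closedBall.2 (hξ k).le
  have hξ₀ : dist ξ₀ 0 = 1 :=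
    mem_sphere.1 (isClosed_sphere.mem_of_tendsto hξlim
      (Eventually.of_forall fun k => mem_sphere.2 (hξ _)))
  -- Step 2: Arzelà–Ascoli on all balls for `w ∘ ψ`
  obtain ⟨φ, hφ, v, V, V2, Zt, hvc, hVc, hV2c, hZtc, hconv⟩ :=
    exists_subseq_jets_tendstoUniformlyOn_forall_ball (fun k => w (ψ k))
      (fun n => ⟨100 * ((n : ℝ) + 1) ^ 3, fun i X hX => jets_bound_of_normalized hα1.le (hC (ψ i))
        (hD2 _) (hT _) (h0 _) (h1 _) (h2 _) (h3 _) n hX⟩)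
      (fun n δ hδ => ⟨min (δ ^ ((α : ℝ)⁻¹)) (δ / (100 * ((n : ℝ) + 1) ^ 3)),
        lt_min (Real.rpow_pos_of_pos hδ _) (by positivity), fun i X hX Y hY hXY =>
          jets_modulus_of_normalized hα0 hα1.le (hC (ψ i)) (hD2 _) (hT _) (h1 _) (h2 _) (h3 _) n
            hδ hX hY hXY⟩)
  -- Step 3: identification of the limits
  obtain ⟨hvC, hsd, hsd2, htd⟩ := isC21On_univ_of_jets_tendsto (fun i => hC (ψ (φ i))) hVc hZtc
    (fun n => (hconv n).1) (fun n => (hconv n).2.1) (fun n => (hconv n).2.2.1)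
    (fun n => (hconv n).2.2.2)
  have hlimD2 : ∀ X, Tendsto (fun i => spaceDeriv (spaceDeriv (w (ψ (φ i)))) X) atTop
      (𝓝 (V2 X)) := fun X => tendsto_of_forall_ball (fun n => (hconv n).2.2.1) X
  have hlimT : ∀ X, Tendsto (fun i => timeDeriv (w (ψ (φ i))) X) atTop (𝓝 (Zt X)) :=
    fun X => tendsto_of_forall_ball (fun n => (hconv n).2.2.2) X
  -- (a) the limits are `α`-Hölder with constant `1`
  have hV2H : ∀ X Y, ‖V2 X - V2 Y‖ ≤ dist X Y ^ (α : ℝ) := fun X Y => by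
    refine le_of_tendsto ((hlimD2 X).sub (hlimD2 Y)).norm (Eventually.of_forall fun i => ?_)
    have h := (hD2 (ψ (φ i))).dist_le_of_le (x := X) (y := Y) le_rfl
    rwa [NNReal.coe_one, one_mul, dist_eq_norm] at h
  have hZtH : ∀ X Y, ‖Zt X - Zt Y‖ ≤ dist X Y ^ (α : ℝ) := fun X Y => by
    refine le_of_tendsto ((hlimT X).sub (hlimT Y)).norm (Eventually.of_forall fun i => ?_)
    have h := (hT (ψ (φ i))).dist_le_of_le (x := X) (y := Y) le_rfl
    rwa [NNReal.coe_one, one_mul, dist_eq_norm] at h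
  -- (b) the values at `0`
  have hV20 : V2 0 = 0 :=
    tendsto_nhds_unique (hlimD2 0) (by simp only [h2]; exact tendsto_const_nhds)
  have hZt0 : Zt 0 = 0 :=
    tendsto_nhds_unique (hlimT 0) (by simp only [h3]; exact tendsto_const_nhds)
  -- (c) the heat equation for the limit
  have hheat : ∀ X, Zt X = ∑ i, V2 X (b i) (b i) := by
    intro X
    have hsum : Tendsto (fun i => ∑ j, spaceDeriv (spaceDeriv (w (ψ (φ i)))) X (b j) (b j)) atTop
        (𝓝 (∑ j, V2 X (b j) (b j))) := by
      refine tendsto_finsetSum _ fun j _ => ?_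
      have hcont : Continuous
          fun L : EuclideanSpace ℝ (Fin m) →L[ℝ] EuclideanSpace ℝ (Fin m) →L[ℝ] F =>
            L (b j) (b j) :=
        (ContinuousLinearMap.apply ℝ F (b j)).continuous.comp
          (ContinuousLinearMap.apply ℝ (EuclideanSpace ℝ (Fin m) →L[ℝ] F) (b j)).continuous
      exact (hcont.tendsto _).comp (hlimD2 X)
    have hdiff : Tendsto (fun i => timeDeriv (w (ψ (φ i))) X -
        ∑ j, spaceDeriv (spaceDeriv (w (ψ (φ i)))) X (b j) (b j)) atTop (𝓝 0) := by
      refine squeeze_zero_norm (fun i => hH (ψ (φ i)) X) ?_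
      have h := (hε.comp ((hψ.comp hφ).tendsto_atTop)).mul_const (dist X 0 ^ (α : ℝ))
      rwa [zero_mul] at h
    exact sub_eq_zero.1 (tendsto_nhds_unique ((hlimT X).sub hsum) hdiff)
  -- (d) the values at `ξ₀`
  have hξmem : ∀ k, ξ k ∈ ball (0 : Parabolic (EuclideanSpace ℝ (Fin m))) ((1 : ℕ) + 1) :=
    fun k => mem_ball.2 (by rw [hξ k]; norm_num)
  have hξlim' : Tendsto (fun i => ξ (ψ (φ i))) atTop
      (𝓝[ball (0 : Parabolic (EuclideanSpace ℝ (Fin m))) ((1 : ℕ) + 1)] ξ₀) :=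
    tendsto_nhdsWithin_iff.2 ⟨hξlim.comp hφ.tendsto_atTop, Eventually.of_forall fun i => hξmem _⟩
  have haD2 : Tendsto (fun i => spaceDeriv (spaceDeriv (w (ψ (φ i)))) (ξ (ψ (φ i)))) atTop
      (𝓝 (V2 ξ₀)) :=
    ((hconv 1).2.2.1).tendsto_comp hV2c.continuousAt.continuousWithinAt hξlim'
  have haT : Tendsto (fun i => timeDeriv (w (ψ (φ i))) (ξ (ψ (φ i)))) atTop (𝓝 (Zt ξ₀)) :=
    ((hconv 1).2.2.2).tendsto_comp hZtc.continuousAt.continuousWithinAt hξlim'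
  have hbig0 : (1 / 4 : ℝ) ≤ max ‖V2 ξ₀‖ ‖Zt ξ₀‖ :=
    ge_of_tendsto (haD2.norm.max haT.norm) (Eventually.of_forall fun i => hbig _)
  -- Step 4: the Liouville theorem for the limit, and the contradiction
  obtain ⟨hc2, hct⟩ := jets_const_of_heat_limit hα1 hvC hvc hVc hV2c hZtc hsd hsd2 htd hV2H hZtH
    hheat
  have e2 : V2 ξ₀ = 0 := (hc2 ξ₀).trans hV20
  have et : Zt ξ₀ = 0 := (hct ξ₀).trans hZt0
  rw [e2, et] at hbig0
  have h00 : ‖(0 : EuclideanSpace ℝ (Fin m) →L[ℝ] EuclideanSpace ℝ (Fin m) →L[ℝ] F)‖ = 0 :=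
    ContinuousLinearMap.opNorm_zero
  rw [h00, norm_zero, max_self] at hbig0
  norm_num at hbig0

/-! ### From the seminorm inequality to the normalized sequence -/

section Reduction

variable {X' Y' : Type*} [MetricSpace X'] [NormedAddCommGroup Y']

/-- A real Hölder inequality gives `HolderWith`. [folklore] -/
theorem holderWith_of_dist_le {C r : ℝ≥0} {f : X' → Y'}
    (h : ∀ x y, dist (f x) (f y) ≤ C * dist x y ^ (r : ℝ)) : HolderWith C r f := by
  intro x y
  rw [edist_dist, edist_dist]
  calc ENNReal.ofReal (dist (f x) (f y)) ≤ ENNReal.ofReal (C * dist x y ^ (r : ℝ)) :=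
        ENNReal.ofReal_le_ofReal (h x y)
    _ = C * ENNReal.ofReal (dist x y) ^ (r : ℝ) := by
        rw [ENNReal.ofReal_mul (NNReal.coe_nonneg C), ENNReal.ofReal_coe_nnreal,
          ENNReal.ofReal_rpow_of_nonneg dist_nonneg (NNReal.coe_nonneg r)]

/-- **Near-optimal pairs for the Hölder seminorm**: if `C < ‖f‖_{C^{0,α}}` (and the seminorm is
finite) there are points with `C d(x, y)^α < dist (f x) (f y)`. [folklore] -/
theorem exists_pair_of_lt_nnHolderNorm {r : ℝ≥0} {f : X' → Y'} {C : ℝ≥0}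
    (hC : C < nnHolderNorm r f) :
    ∃ x y : X', (C : ℝ) * dist x y ^ (r : ℝ) < dist (f x) (f y) := by
  by_contra h
  have h' : ∀ x y, dist (f x) (f y) ≤ C * dist x y ^ (r : ℝ) := fun x y =>
    not_lt.1 fun hlt => h ⟨x, y, hlt⟩
  exact absurd (holderWith_of_dist_le h').nnholderNorm_le (not_le.2 hC)

/-- Distances of recentred dilated points: `d(X + δ_ρ Z, X + δ_ρ Z') = ρ d(Z, Z')`. [folklore] -/
theorem dist_add_dilation (X Z Z' : Parabolic (EuclideanSpace ℝ (Fin m))) {ρ : ℝ} (hρ : 0 ≤ ρ) :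
    dist (X + dilation ρ Z) (X + dilation ρ Z') = ρ * dist Z Z' := by
  rw [add_comm X, add_comm X, Parabolic.dist_add_right, dist_dilation hρ]

/-- Rescaled recentred differences `Z ↦ κ (g(X + δ_ρ Z) - g(X))` of an `α`-Hölder `g` (constant
`C ≤ S`) are `α`-Hölder with constant `1` once `κ ρ^α = S⁻¹`. [folklore] -/
theorem holderWith_one_rescale {G : Type*} [NormedAddCommGroup G] [NormedSpace ℝ G]
    {g : Parabolic (EuclideanSpace ℝ (Fin m)) → G} {C S α : ℝ≥0} {κ ρ : ℝ}
    (hg : HolderWith C α g) (hCS : C ≤ S) (hS0 : (0 : ℝ) < S) (hρ0 : 0 < ρ) (hκ0 : 0 < κ)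
    (hκρ : κ * ρ ^ (α : ℝ) = (S : ℝ)⁻¹) (X : Parabolic (EuclideanSpace ℝ (Fin m))) :
    HolderWith 1 α (fun Z => κ • (g (X + dilation ρ Z) - g X)) := by
  refine holderWith_of_dist_le fun Z Z' => ?_
  rw [dist_eq_norm, ← smul_sub, sub_sub_sub_cancel_right, norm_smul, Real.norm_eq_abs,
    abs_of_pos hκ0, NNReal.coe_one, one_mul]
  have h := hg.dist_le (X + dilation ρ Z) (X + dilation ρ Z')
  rw [dist_eq_norm, dist_add_dilation _ _ _ hρ0.le, Real.mul_rpow hρ0.le dist_nonneg] at h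
  calc κ * ‖g (X + dilation ρ Z) - g (X + dilation ρ Z')‖
      ≤ κ * (C * (ρ ^ (α : ℝ) * dist Z Z' ^ (α : ℝ))) := mul_le_mul_of_nonneg_left h hκ0.le
    _ = (κ * ρ ^ (α : ℝ)) * C * dist Z Z' ^ (α : ℝ) := by ring
    _ ≤ 1 * dist Z Z' ^ (α : ℝ) := by
        rw [hκρ]
        refine mul_le_mul_of_nonneg_right ?_ (by positivity)
        rw [inv_mul_le_iff₀ hS0, mul_one]
        exact_mod_cast hCS
    _ = dist Z Z' ^ (α : ℝ) := one_mul _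

/-- The size bookkeeping at the near-optimal pair: `S/4 · ρ^α < ‖gX - gY‖` and `κ ρ^α = S⁻¹` give
`¼ ≤ ‖κ (gY - gX)‖`. [folklore] -/
theorem quarter_le_norm_smul_sub {G : Type*} [NormedAddCommGroup G] [NormedSpace ℝ G] {gX gY : G}
    {S : ℝ≥0} {κ ρ α : ℝ} (hS0 : (0 : ℝ) < S) (hκ0 : 0 < κ) (hκρ : κ * ρ ^ α = (S : ℝ)⁻¹)
    (h : (S : ℝ) / 4 * ρ ^ α < ‖gX - gY‖) : (1 / 4 : ℝ) ≤ ‖κ • (gY - gX)‖ := by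
  rw [norm_smul, Real.norm_eq_abs, abs_of_pos hκ0, norm_sub_rev]
  have h2 : κ * ((S : ℝ) / 4 * ρ ^ α) ≤ κ * ‖gX - gY‖ := mul_le_mul_of_nonneg_left h.le hκ0.le
  have h3 : κ * ((S : ℝ) / 4 * ρ ^ α) = 1 / 4 := by
    calc κ * ((S : ℝ) / 4 * ρ ^ α) = (κ * ρ ^ α) * S / 4 := by ring
      _ = 1 / 4 := by rw [hκρ, inv_mul_cancel₀ hS0.ne']
  linarith

omit [FiniteDimensional ℝ F] in
/-- **The normalized blow-up of a function violating the seminorm inequality.**  If `u` satisfies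
the guard everywhere, `D² u`, `∂ₜ u` are `α`-Hölder, and
`(k + 1) ‖∂ₜ u - tr D² u‖_{C^{0,α}} < ‖D² u‖_{C^{0,α}} + ‖∂ₜ u‖_{C^{0,α}}`, then a recentred,
dilated, rescaled and Taylor-normalized copy `w` of `u` has the properties excluded by
`blowUp_core` with `ε = 1/(k+1)`. [folklore] -/
theorem exists_normalized_of_lt {α : ℝ≥0} (hα0 : 0 < α)
    {u : Parabolic (EuclideanSpace ℝ (Fin m)) → F} (hu : IsC21On u univ)
    (hD : MemHolder α (spaceDeriv (spaceDeriv u))) (hT : MemHolder α (timeDeriv u)) {k : ℕ}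
    (hlt : ((k : ℝ≥0) + 1) * nnHolderNorm α (fun X => timeDeriv u X -
      ∑ i, spaceDeriv (spaceDeriv u) X (stdOrthonormalBasis ℝ (EuclideanSpace ℝ (Fin m)) i)
        (stdOrthonormalBasis ℝ (EuclideanSpace ℝ (Fin m)) i)) <
      nnHolderNorm α (spaceDeriv (spaceDeriv u)) + nnHolderNorm α (timeDeriv u)) :
    ∃ (w : Parabolic (EuclideanSpace ℝ (Fin m)) → F) (ξ : Parabolic (EuclideanSpace ℝ (Fin m))),
      IsC21On w univ ∧ HolderWith 1 α (spaceDeriv (spaceDeriv w)) ∧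
      HolderWith 1 α (timeDeriv w) ∧ w 0 = 0 ∧ spaceDeriv w 0 = 0 ∧
      spaceDeriv (spaceDeriv w) 0 = 0 ∧ timeDeriv w 0 = 0 ∧
      (∀ Z, ‖timeDeriv w Z - ∑ i, spaceDeriv (spaceDeriv w) Z
        (stdOrthonormalBasis ℝ (EuclideanSpace ℝ (Fin m)) i)
        (stdOrthonormalBasis ℝ (EuclideanSpace ℝ (Fin m)) i)‖ ≤
          (1 / ((k : ℝ) + 1)) * dist Z 0 ^ (α : ℝ)) ∧
      dist ξ 0 = 1 ∧
      (1 / 4 : ℝ) ≤ max ‖spaceDeriv (spaceDeriv w) ξ‖ ‖timeDeriv w ξ‖ := by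
  set b := stdOrthonormalBasis ℝ (EuclideanSpace ℝ (Fin m)) with hb
  set D2 := spaceDeriv (spaceDeriv u) with hD2def
  set Tu := timeDeriv u with hTudef
  set Hu : Parabolic (EuclideanSpace ℝ (Fin m)) → F := fun X => Tu X - ∑ i, D2 X (b i) (b i)
    with hHudef
  set nD := nnHolderNorm α D2 with hnD
  set nT := nnHolderNorm α Tu with hnT
  set N := nnHolderNorm α Hu with hN
  set S := nD + nT with hS
  have hDH : HolderWith nD α D2 := hD.holderWith
  have hTH : HolderWith nT α Tu := hT.holderWith
  -- the heat operator is Hölder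
  have hb1 : ∀ i, ‖b i‖ = 1 := fun i => b.orthonormal.1 i
  have hHuH : HolderWith
      (nT + Fintype.card (Fin (Module.finrank ℝ (EuclideanSpace ℝ (Fin m)))) * nD) α Hu := by
    refine holderWith_of_dist_le fun X Y => ?_
    rw [dist_eq_norm]
    have h1 : ‖Tu X - Tu Y‖ ≤ nT * dist X Y ^ (α : ℝ) := by
      rw [← dist_eq_norm]; exact hTH.dist_le X Y
    have h2 : ∀ i, ‖D2 X (b i) (b i) - D2 Y (b i) (b i)‖ ≤ nD * dist X Y ^ (α : ℝ) := by
      intro i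
      have hsub : D2 X (b i) (b i) - D2 Y (b i) (b i) = (D2 X - D2 Y) (b i) (b i) := rfl
      rw [hsub]
      calc ‖(D2 X - D2 Y) (b i) (b i)‖ ≤ ‖D2 X - D2 Y‖ * ‖b i‖ * ‖b i‖ :=
            (D2 X - D2 Y).le_opNorm₂ _ _
        _ = ‖D2 X - D2 Y‖ := by rw [hb1, mul_one, mul_one]
        _ ≤ nD * dist X Y ^ (α : ℝ) := by rw [← dist_eq_norm]; exact hDH.dist_le X Y
    have h3 : ‖∑ i, D2 X (b i) (b i) - ∑ i, D2 Y (b i) (b i)‖ ≤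
        Fintype.card (Fin (Module.finrank ℝ (EuclideanSpace ℝ (Fin m)))) *
          (nD * dist X Y ^ (α : ℝ)) := by
      rw [← Finset.sum_sub_distrib]
      refine (norm_sum_le _ _).trans ?_
      calc ∑ i, ‖D2 X (b i) (b i) - D2 Y (b i) (b i)‖ ≤ ∑ _i : Fin (Module.finrank ℝ
            (EuclideanSpace ℝ (Fin m))), nD * dist X Y ^ (α : ℝ) :=
            Finset.sum_le_sum fun i _ => h2 i
        _ = _ := by rw [Finset.sum_const, Finset.card_univ, nsmul_eq_mul]
    have hE : Hu X - Hu Y = (Tu X - Tu Y) - (∑ i, D2 X (b i) (b i) - ∑ i, D2 Y (b i) (b i)) := by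
      simp only [hHudef]; abel
    calc ‖Hu X - Hu Y‖ = ‖(Tu X - Tu Y) - (∑ i, D2 X (b i) (b i) - ∑ i, D2 Y (b i) (b i))‖ := by
          rw [hE]
      _ ≤ ‖Tu X - Tu Y‖ + ‖∑ i, D2 X (b i) (b i) - ∑ i, D2 Y (b i) (b i)‖ := norm_sub_le _ _
      _ ≤ nT * dist X Y ^ (α : ℝ) + Fintype.card (Fin (Module.finrank ℝ (EuclideanSpace ℝ
            (Fin m)))) * (nD * dist X Y ^ (α : ℝ)) := add_le_add h1 h3
      _ = _ := by push_cast; ring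
  have hNH : HolderWith N α Hu := hHuH.memHolder.holderWith
  -- `S > 0` and `N / S < 1 / (k+1)`
  have hS0 : 0 < S := lt_of_le_of_lt (by positivity) hlt
  have hS0' : (0 : ℝ) < S := NNReal.coe_pos.2 hS0
  have hNS : (N : ℝ) / S ≤ 1 / ((k : ℝ) + 1) := by
    rw [div_le_div_iff₀ hS0' (by positivity), one_mul]
    have h := NNReal.coe_lt_coe.2 hlt
    push_cast at h
    linarith
  -- a near-optimal pair for the larger of the two seminorms
  obtain ⟨X, Y, hXY⟩ : ∃ X Y : Parabolic (EuclideanSpace ℝ (Fin m)),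
      (S : ℝ) / 4 * dist X Y ^ (α : ℝ) < ‖D2 X - D2 Y‖ ∨
      (S : ℝ) / 4 * dist X Y ^ (α : ℝ) < ‖Tu X - Tu Y‖ := by
    have hS4 : S / 4 < S / 2 := by
      rw [div_lt_div_iff₀ (by norm_num) (by norm_num)]; 
      calc S * 2 < S * 2 + S * 2 := lt_add_of_pos_right _ (by positivity)
        _ = S * 4 := by ring
    rcases le_or_gt (S / 2) nD with h | h
    · obtain ⟨X, Y, hXY⟩ := exists_pair_of_lt_nnHolderNorm (hS4.trans_le h)
      refine ⟨X, Y, Or.inl ?_⟩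
      rw [dist_eq_norm] at hXY; push_cast at hXY; exact hXY
    · have h' : S / 2 ≤ nT := by
        have : nD + nT = S := rfl
        have h2 : S / 2 + S / 2 = S := add_halves S
        by_contra hc; push Not at hc
        have := add_lt_add h hc
        rw [h2] at this
        exact (lt_irrefl _) this
      obtain ⟨X, Y, hXY⟩ := exists_pair_of_lt_nnHolderNorm (hS4.trans_le h')
      refine ⟨X, Y, Or.inr ?_⟩
      rw [dist_eq_norm] at hXY; push_cast at hXY; exact hXY
  -- the scale `ρ = d(X, Y) > 0`
  set ρ : ℝ := dist X Y with hρ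
  have hρ0 : 0 < ρ := by
    have hpos : (0 : ℝ) < (S : ℝ) / 4 * dist X Y ^ (α : ℝ) ∨ 0 < dist X Y := by
      rcases hXY with h | h
      · by_contra hc; push Not at hc
        have hd : dist X Y = 0 := le_antisymm hc.2 dist_nonneg
        have hXYeq : X = Y := dist_eq_zero.1 hd
        rw [hXYeq, sub_self, norm_zero] at h
        exact (lt_irrefl _) (h.trans_le' (by positivity))
      · by_contra hc; push Not at hc
        have hd : dist X Y = 0 := le_antisymm hc.2 dist_nonneg
        have hXYeq : X = Y := dist_eq_zero.1 hd
        rw [hXYeq, sub_self, norm_zero] at h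
        exact (lt_irrefl _) (h.trans_le' (by positivity))
    rcases hpos with h | h
    · by_contra hc; push Not at hc
      have hd : dist X Y = 0 := le_antisymm hc dist_nonneg
      rw [hd, Real.zero_rpow (NNReal.coe_pos.2 hα0).ne', mul_zero] at h
      exact (lt_irrefl _) h
    · exact h
  -- the rescaled, recentred, Taylor-normalized function
  set κ : ℝ := (S : ℝ)⁻¹ * ρ ^ (-(α : ℝ)) with hκ
  have hκ0 : 0 < κ := by positivity
  have hκρ : κ * ρ ^ (α : ℝ) = (S : ℝ)⁻¹ := by
    rw [hκ, mul_assoc, ← Real.rpow_add hρ0, neg_add_cancel, Real.rpow_zero, mul_one]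
  obtain ⟨w, hwC, hw0, hw1, hwD2, hwT⟩ := exists_blowUp_normalization hu X ρ (κ / ρ ^ 2)
  have hcρ : κ / ρ ^ 2 * ρ ^ 2 = κ := div_mul_cancel₀ κ (by positivity)
  simp only [hcρ] at hwD2 hwT
  -- the jets of `w` at dilated points
  have hA0 : X + dilation ρ 0 = X := by
    rw [Literature.Geometry.Riemannian.ParabolicFlow.dilation_zero', add_zero]
  have hwD20 : spaceDeriv (spaceDeriv w) 0 = 0 := by rw [hwD2, hA0, sub_self, smul_zero]
  have hwT0 : timeDeriv w 0 = 0 := by rw [hwT, hA0, sub_self, smul_zero]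
  -- Hölder bounds with constant `1`
  have hwD2H : HolderWith 1 α (spaceDeriv (spaceDeriv w)) := by
    have h := holderWith_one_rescale hDH (le_self_add : nD ≤ S) hS0' hρ0 hκ0 hκρ X
    rwa [show (fun Z => κ • (D2 (X + dilation ρ Z) - D2 X)) = spaceDeriv (spaceDeriv w) from
      (funext hwD2).symm] at h
  have hwTH : HolderWith 1 α (timeDeriv w) := by
    have h := holderWith_one_rescale hTH (le_add_self : nT ≤ S) hS0' hρ0 hκ0 hκρ X
    rwa [show (fun Z => κ • (Tu (X + dilation ρ Z) - Tu X)) = timeDeriv w from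
      (funext hwT).symm] at h
  -- the heat operator of `w`
  have hwH : ∀ Z, timeDeriv w Z - ∑ i, spaceDeriv (spaceDeriv w) Z (b i) (b i) =
      κ • (Hu (X + dilation ρ Z) - Hu X) := by
    intro Z
    rw [hwT, hHudef]
    simp only [hwD2, FunLike.coe_smul, Pi.smul_apply, FunLike.coe_sub, Pi.sub_apply, smul_sub,
      Finset.smul_sum, Finset.sum_sub_distrib]
    abel
  have hwHb : ∀ Z, ‖timeDeriv w Z - ∑ i, spaceDeriv (spaceDeriv w) Z (b i) (b i)‖ ≤
      (1 / ((k : ℝ) + 1)) * dist Z 0 ^ (α : ℝ) := by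
    intro Z
    rw [hwH, norm_smul, Real.norm_eq_abs, abs_of_pos hκ0]
    have h := hNH.dist_le (X + dilation ρ Z) X
    rw [dist_eq_norm] at h
    have hd : dist (X + dilation ρ Z) X = ρ * dist Z 0 := by
      have h' := dist_add_dilation X Z 0 hρ0.le
      rwa [hA0] at h'
    rw [hd, Real.mul_rpow hρ0.le dist_nonneg] at h
    calc κ * ‖Hu (X + dilation ρ Z) - Hu X‖ ≤ κ * (N * (ρ ^ (α : ℝ) * dist Z 0 ^ (α : ℝ))) :=
          mul_le_mul_of_nonneg_left h hκ0.le
      _ = (κ * ρ ^ (α : ℝ)) * N * dist Z 0 ^ (α : ℝ) := by ring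
      _ = (N / S) * dist Z 0 ^ (α : ℝ) := by rw [hκρ, inv_mul_eq_div]
      _ ≤ (1 / ((k : ℝ) + 1)) * dist Z 0 ^ (α : ℝ) :=
          mul_le_mul_of_nonneg_right hNS (by positivity)
  -- the point `ξ` with `X + δ_ρ ξ = Y`
  set ξ : Parabolic (EuclideanSpace ℝ (Fin m)) := dilation ρ⁻¹ (Y - X) with hξ
  have hAξ : X + dilation ρ ξ = Y := by
    rw [hξ, dilation_dilation, mul_inv_cancel₀ hρ0.ne', dilation_one, add_sub_cancel]
  have hξ1 : dist ξ 0 = 1 := by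
    rw [hξ, ← Literature.Geometry.Riemannian.ParabolicFlow.dilation_zero' ρ⁻¹,
      dist_dilation (inv_nonneg.2 hρ0.le), ← sub_self X,
      Parabolic.dist_sub_right, dist_comm, ← hρ, inv_mul_cancel₀ hρ0.ne']
  refine ⟨w, ξ, hwC, hwD2H, hwTH, hw0, hw1, hwD20, hwT0, hwHb, hξ1, ?_⟩
  -- the size at `ξ`
  rcases hXY with h | h
  · refine le_max_of_le_left ?_
    rw [hwD2, hAξ]
    exact quarter_le_norm_smul_sub hS0' hκ0 hκρ h
  · refine le_max_of_le_right ?_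
    rw [hwT, hAξ]
    exact quarter_le_norm_smul_sub hS0' hκ0 hκρ h

/-- **The global Hölder seminorm estimate for the heat operator** (the scale-invariant core of the
interior Schauder estimate, White 2005 Thm. 8.2, by L. Simon's blow-up method): for `0 < α < 1`
there is `C = C(m, α, F)` such that every `u : R^m × ℝ → F` satisfying the regularity guard
everywhere, with `D² u` and `∂ₜ u` globally `α`-Hölder for the parabolic distance, obeys
`‖D² u‖_{C^{0,α}} + ‖∂ₜ u‖_{C^{0,α}} ≤ C ‖∂ₜ u - tr D² u‖_{C^{0,α}}`
(seminorms `nnHolderNorm` on all of spacetime; `tr` in the frame `stdOrthonormalBasis`).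
[cite: White2005, Thm. 8.2] -/
theorem nnHolderNorm_jets_le_heat {α : ℝ≥0} (hα0 : 0 < α) (hα1 : α < 1) :
    ∃ C : ℝ≥0, ∀ u : Parabolic (EuclideanSpace ℝ (Fin m)) → F, IsC21On u univ →
      MemHolder α (spaceDeriv (spaceDeriv u)) → MemHolder α (timeDeriv u) →
      nnHolderNorm α (spaceDeriv (spaceDeriv u)) + nnHolderNorm α (timeDeriv u) ≤
        C * nnHolderNorm α (fun X => timeDeriv u X - ∑ i, spaceDeriv (spaceDeriv u) X
          (stdOrthonormalBasis ℝ (EuclideanSpace ℝ (Fin m)) i)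
          (stdOrthonormalBasis ℝ (EuclideanSpace ℝ (Fin m)) i)) := by
  by_contra hcon
  push Not at hcon
  choose u hu hD hT hlt using fun k : ℕ => hcon ((k : ℝ≥0) + 1)
  choose w ξ hwC hwD2 hwT hw0 hw1 hw2 hw3 hwH hξ hbig using fun k =>
    exists_normalized_of_lt hα0 (hu k) (hD k) (hT k) (hlt k)
  exact blowUp_core hα0 hα1 w hwC hwD2 hwT hw0 hw1 hw2 hw3 (fun k => 1 / ((k : ℝ) + 1))
    tendsto_one_div_add_atTop_nhds_zero_nat hwH ξ hξ hbig

end Reduction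

/-! ### The expanding-domain blow-up (White's use of the Schauder estimate)

White applies the interior Schauder estimate (Thm. 8.2) only in the following form (pp. 1499 and
1505): graph functions `uᵢ` on growing domains, uniformly bounded in `C^{2,α}` on compact sets,
converging to `0` in `C²` on compact sets, with `L uᵢ → 0` in `C^α` on compact sets, converge to
`0` in `C^{2,α}` on compact sets.  We prove this convergence statement directly by the blow-up
method, on expanding domains (`blowUp_core_local`, `jets_holder_eventually_le_of_heat`), which
avoids cutoffs, interpolation and absorption altogether. -/

section Local

open Literature.Geometry.Riemannian.ParabolicFlow

/-- `jets_const_of_heat_limit` with an arbitrary Hölder constant `A ≥ 0` (scaling by `A⁻¹`).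
[folklore] -/
theorem jets_const_of_heat_limit_of_le {α : ℝ≥0} (hα1 : α < 1) {A : ℝ} (hA : 0 ≤ A)
    {v : Parabolic (EuclideanSpace ℝ (Fin m)) → F} (hvC : IsC21On v univ) (hvc : Continuous v)
    {V : Parabolic (EuclideanSpace ℝ (Fin m)) → (EuclideanSpace ℝ (Fin m) →L[ℝ] F)}
    {V2 : Parabolic (EuclideanSpace ℝ (Fin m)) →
      (EuclideanSpace ℝ (Fin m) →L[ℝ] EuclideanSpace ℝ (Fin m) →L[ℝ] F)}
    {Zt : Parabolic (EuclideanSpace ℝ (Fin m)) → F}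
    (hVc : Continuous V) (hV2c : Continuous V2) (hZtc : Continuous Zt)
    (hsd : ∀ X, spaceDeriv v X = V X) (hsd2 : ∀ X, spaceDeriv (spaceDeriv v) X = V2 X)
    (htd : ∀ X, timeDeriv v X = Zt X)
    (hV2H : ∀ X Y, ‖V2 X - V2 Y‖ ≤ A * dist X Y ^ (α : ℝ))
    (hZtH : ∀ X Y, ‖Zt X - Zt Y‖ ≤ A * dist X Y ^ (α : ℝ))
    (hheat : ∀ X, Zt X = ∑ i, V2 X (stdOrthonormalBasis ℝ (EuclideanSpace ℝ (Fin m)) i)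
      (stdOrthonormalBasis ℝ (EuclideanSpace ℝ (Fin m)) i)) :
    (∀ X, V2 X = V2 0) ∧ (∀ X, Zt X = Zt 0) := by
  rcases hA.eq_or_lt with hA0 | hA0
  · -- `A = 0`: the jets are constant outright
    refine ⟨fun X => ?_, fun X => ?_⟩
    · have h := hV2H X 0; rw [← hA0, zero_mul] at h
      exact sub_eq_zero.1 (norm_le_zero_iff.1 h)
    · have h := hZtH X 0; rw [← hA0, zero_mul] at h
      exact sub_eq_zero.1 (norm_le_zero_iff.1 h)
  -- `A > 0`: rescale by `A⁻¹`
  have hAi : 0 < A⁻¹ := inv_pos.2 hA0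
  have hsd' : ∀ X, spaceDeriv (A⁻¹ • v) X = (A⁻¹ • V) X := fun X => by
    rw [spaceDeriv_const_smul, Pi.smul_apply, Pi.smul_apply, hsd]
  have hsd2' : ∀ X, spaceDeriv (spaceDeriv (A⁻¹ • v)) X = (A⁻¹ • V2) X := fun X => by
    rw [spaceDeriv_const_smul, spaceDeriv_const_smul, Pi.smul_apply, Pi.smul_apply, hsd2]
  have htd' : ∀ X, timeDeriv (A⁻¹ • v) X = (A⁻¹ • Zt) X := fun X => by
    rw [timeDeriv_const_smul, Pi.smul_apply, Pi.smul_apply, htd]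
  have hHol : ∀ {G : Type _} [NormedAddCommGroup G] [NormedSpace ℝ G]
      (g : Parabolic (EuclideanSpace ℝ (Fin m)) → G),
      (∀ X Y, ‖g X - g Y‖ ≤ A * dist X Y ^ (α : ℝ)) →
      ∀ X Y, ‖(A⁻¹ • g) X - (A⁻¹ • g) Y‖ ≤ dist X Y ^ (α : ℝ) := by
    intro G _ _ g hg X Y
    rw [Pi.smul_apply, Pi.smul_apply, ← smul_sub, norm_smul, Real.norm_eq_abs, abs_of_pos hAi]
    calc A⁻¹ * ‖g X - g Y‖ ≤ A⁻¹ * (A * dist X Y ^ (α : ℝ)) :=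
          mul_le_mul_of_nonneg_left (hg X Y) hAi.le
      _ = dist X Y ^ (α : ℝ) := by rw [← mul_assoc, inv_mul_cancel₀ hA0.ne', one_mul]
  have hheat' : ∀ X, (A⁻¹ • Zt) X = ∑ i, (A⁻¹ • V2) X
      (stdOrthonormalBasis ℝ (EuclideanSpace ℝ (Fin m)) i)
      (stdOrthonormalBasis ℝ (EuclideanSpace ℝ (Fin m)) i) := fun X => by
    simp only [Pi.smul_apply, hheat X, Finset.smul_sum, FunLike.coe_smul]
  obtain ⟨h2, ht⟩ := jets_const_of_heat_limit hα1 (isC21On_const_smul hvC A⁻¹)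
    (hvc.const_smul A⁻¹) (hVc.const_smul A⁻¹) (hV2c.const_smul A⁻¹) (hZtc.const_smul A⁻¹)
    hsd' hsd2' htd' (hHol V2 hV2H) (hHol Zt hZtH) hheat'
  refine ⟨fun X => ?_, fun X => ?_⟩
  · have h := h2 X
    simp only [Pi.smul_apply] at h
    exact smul_right_injective _ hAi.ne' h
  · have h := ht X
    simp only [Pi.smul_apply] at h
    exact smul_right_injective _ hAi.ne' h

omit [FiniteDimensional ℝ F] in
/-- Polynomial bookkeeping for the local jet bounds with Hölder constant `K`: with `R = n + 1` and
`M = K (1 + 3R)`, all the constants of `ParabolicJetsLocalBounds` are `≤ 100 (K + 1) R³`.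
[folklore] -/
theorem constants_le_hundred_cube_mul (n : ℕ) {K : ℝ} (hK : 0 ≤ K) :
    0 < (n : ℝ) + 1 ∧
    (3 * (K * (1 + 3 * ((n : ℝ) + 1))) + 3 * (K * (1 + 3 * ((n : ℝ) + 1)))) * ((n : ℝ) + 1) *
      ((n : ℝ) + 1) ≤ 100 * (K + 1) * ((n : ℝ) + 1) ^ 3 ∧
    (K * (1 + 3 * ((n : ℝ) + 1)) + 3 * (K * (1 + 3 * ((n : ℝ) + 1)))) * ((n : ℝ) + 1) ≤
      100 * (K + 1) * ((n : ℝ) + 1) ^ 3 ∧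
    K * (1 + 3 * ((n : ℝ) + 1)) ≤ 100 * (K + 1) * ((n : ℝ) + 1) ^ 3 ∧
    (3 * (K * (1 + 3 * ((n : ℝ) + 1))) + 3 * (K * (1 + 3 * ((n : ℝ) + 1)))) * ((n : ℝ) + 1) ≤
      100 * (K + 1) * ((n : ℝ) + 1) ^ 3 ∧
    K * (1 + 3 * ((n : ℝ) + 1)) + 3 * (K * (1 + 3 * ((n : ℝ) + 1))) ≤
      100 * (K + 1) * ((n : ℝ) + 1) ^ 3 := by
  have hn : (0 : ℝ) ≤ n := Nat.cast_nonneg n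
  set R : ℝ := (n : ℝ) + 1 with hR
  have hR1 : 1 ≤ R := by rw [hR]; linarith
  have hRR : R ≤ R ^ 2 := by nlinarith
  have hRRR : R ^ 2 ≤ R ^ 3 := by nlinarith
  have hq1 : 6 * (1 + 3 * R) * R * R ≤ 100 * R ^ 3 := by nlinarith
  have hq2 : 4 * (1 + 3 * R) * R ≤ 100 * R ^ 3 := by nlinarith
  have hq3 : 1 + 3 * R ≤ 100 * R ^ 3 := by nlinarith
  have hq4 : 4 * (1 + 3 * R) ≤ 100 * R ^ 3 := by nlinarith
  have hK1 : K ≤ K + 1 := by linarith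
  have hR3 : 0 ≤ 100 * R ^ 3 := by positivity
  have key : ∀ q : ℝ, 0 ≤ q → q ≤ 100 * R ^ 3 → K * q ≤ 100 * (K + 1) * R ^ 3 := by
    intro q hq0 hq
    calc K * q ≤ (K + 1) * (100 * R ^ 3) := mul_le_mul hK1 hq hq0 (by linarith)
      _ = 100 * (K + 1) * R ^ 3 := by ring
  refine ⟨by positivity, ?_, ?_, ?_, ?_, ?_⟩
  · have h := key _ (by positivity) hq1; linarith [h]
  · have h := key _ (by positivity) hq2; linarith [h]
  · exact key _ (by positivity) hq3
  · have h := key _ (by positivity) (by linarith [hq1, hq2] : 6 * (1 + 3 * R) * R ≤ 100 * R ^ 3)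
    linarith [h]
  · have h := key _ (by positivity) hq4; linarith [h]

omit [FiniteDimensional ℝ F] in
/-- **Local jet bounds, Hölder constant `K`, guard on `B(0, 3(n+1))` only**: if `w` satisfies the
guard on `B(0, 3R)`, `R = n+1`, with `w(0) = 0`, `D w(0) = 0` and `‖D² w‖, ‖∂ₜ w‖ ≤ K(1 + 3R)`
there, then the four jets are bounded by `100 (K+1) R³` on `B(0, R)`. [folklore] -/
theorem jets_bound_of_normalized_local {K : ℝ} (hK : 0 ≤ K) (n : ℕ)
    {w : Parabolic (EuclideanSpace ℝ (Fin m)) → F}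
    (hC : IsC21On w (ball (0 : Parabolic (EuclideanSpace ℝ (Fin m))) (3 * ((n : ℝ) + 1))))
    (h0 : w 0 = 0) (h1 : spaceDeriv w 0 = 0)
    (hM₁ : ∀ Z ∈ ball (0 : Parabolic (EuclideanSpace ℝ (Fin m))) (3 * ((n : ℝ) + 1)),
      ‖timeDeriv w Z‖ ≤ K * (1 + 3 * ((n : ℝ) + 1)))
    (hM₂ : ∀ Z ∈ ball (0 : Parabolic (EuclideanSpace ℝ (Fin m))) (3 * ((n : ℝ) + 1)),
      ‖spaceDeriv (spaceDeriv w) Z‖ ≤ K * (1 + 3 * ((n : ℝ) + 1)))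
    {X : Parabolic (EuclideanSpace ℝ (Fin m))}
    (hX : X ∈ ball (0 : Parabolic (EuclideanSpace ℝ (Fin m))) ((n : ℝ) + 1)) :
    ‖w X‖ ≤ 100 * (K + 1) * ((n : ℝ) + 1) ^ 3 ∧
      ‖spaceDeriv w X‖ ≤ 100 * (K + 1) * ((n : ℝ) + 1) ^ 3 ∧
      ‖spaceDeriv (spaceDeriv w) X‖ ≤ 100 * (K + 1) * ((n : ℝ) + 1) ^ 3 ∧
        ‖timeDeriv w X‖ ≤ 100 * (K + 1) * ((n : ℝ) + 1) ^ 3 := by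
  obtain ⟨hR0, hp1, hp2, hp3, -, -⟩ := constants_le_hundred_cube_mul n hK
  have hX3 : X ∈ ball (0 : Parabolic (EuclideanSpace ℝ (Fin m))) (3 * ((n : ℝ) + 1)) :=
    ball_subset_ball (by linarith) hX
  exact ⟨(norm_le_of_bounds_local hC h0 h1 hR0 hM₁ hM₂ hX).trans hp1,
    (norm_spaceDeriv_le_of_bounds_local hC h1 hR0 hM₁ hM₂ hX).trans hp2, (hM₂ X hX3).trans hp3,
    (hM₁ X hX3).trans hp3⟩

omit [FiniteDimensional ℝ F] in
/-- **Local jet moduli, Hölder constant `K`, guard on `B(0, 3(n+1))` only.** [folklore] -/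
theorem jets_modulus_of_normalized_local {α : ℝ≥0} (hα0 : 0 < α) {K : ℝ} (hK : 0 ≤ K) (n : ℕ)
    {w : Parabolic (EuclideanSpace ℝ (Fin m)) → F}
    (hC : IsC21On w (ball (0 : Parabolic (EuclideanSpace ℝ (Fin m))) (3 * ((n : ℝ) + 1))))
    (h1 : spaceDeriv w 0 = 0)
    (hM₁ : ∀ Z ∈ ball (0 : Parabolic (EuclideanSpace ℝ (Fin m))) (3 * ((n : ℝ) + 1)),
      ‖timeDeriv w Z‖ ≤ K * (1 + 3 * ((n : ℝ) + 1)))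
    (hM₂ : ∀ Z ∈ ball (0 : Parabolic (EuclideanSpace ℝ (Fin m))) (3 * ((n : ℝ) + 1)),
      ‖spaceDeriv (spaceDeriv w) Z‖ ≤ K * (1 + 3 * ((n : ℝ) + 1)))
    (hD2 : ∀ X ∈ ball (0 : Parabolic (EuclideanSpace ℝ (Fin m))) ((n : ℝ) + 1),
      ∀ Y ∈ ball (0 : Parabolic (EuclideanSpace ℝ (Fin m))) ((n : ℝ) + 1),
      ‖spaceDeriv (spaceDeriv w) X - spaceDeriv (spaceDeriv w) Y‖ ≤ K * dist X Y ^ (α : ℝ))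
    (hT : ∀ X ∈ ball (0 : Parabolic (EuclideanSpace ℝ (Fin m))) ((n : ℝ) + 1),
      ∀ Y ∈ ball (0 : Parabolic (EuclideanSpace ℝ (Fin m))) ((n : ℝ) + 1),
      ‖timeDeriv w X - timeDeriv w Y‖ ≤ K * dist X Y ^ (α : ℝ))
    {δ : ℝ} (hδ : 0 < δ) {X Y : Parabolic (EuclideanSpace ℝ (Fin m))}
    (hX : X ∈ ball (0 : Parabolic (EuclideanSpace ℝ (Fin m))) ((n : ℝ) + 1))
    (hY : Y ∈ ball (0 : Parabolic (EuclideanSpace ℝ (Fin m))) ((n : ℝ) + 1))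
    (hXY : dist X Y < min ((δ / (K + 1)) ^ ((α : ℝ)⁻¹))
      (δ / (100 * (K + 1) * ((n : ℝ) + 1) ^ 3))) :
    ‖w X - w Y‖ ≤ δ ∧ ‖spaceDeriv w X - spaceDeriv w Y‖ ≤ δ ∧
      ‖spaceDeriv (spaceDeriv w) X - spaceDeriv (spaceDeriv w) Y‖ ≤ δ ∧
        ‖timeDeriv w X - timeDeriv w Y‖ ≤ δ := by
  obtain ⟨hR0, -, -, -, hp4, hp5⟩ := constants_le_hundred_cube_mul n hK
  have hK1 : 0 < K + 1 := by linarith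
  have hXY1 : dist X Y < (δ / (K + 1)) ^ ((α : ℝ)⁻¹) := lt_of_lt_of_le hXY (min_le_left _ _)
  have hXY2 : dist X Y < δ / (100 * (K + 1) * ((n : ℝ) + 1) ^ 3) :=
    lt_of_lt_of_le hXY (min_le_right _ _)
  have hdα : dist X Y ^ (α : ℝ) ≤ δ / (K + 1) :=
    rpow_le_of_lt_rpow_inv (div_pos hδ hK1) hα0 dist_nonneg hXY1
  have hKd : K * dist X Y ^ (α : ℝ) ≤ δ := by
    calc K * dist X Y ^ (α : ℝ) ≤ (K + 1) * (δ / (K + 1)) :=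
          mul_le_mul (by linarith) hdα (by positivity) hK1.le
      _ = δ := mul_div_cancel₀ δ hK1.ne'
  have hL : 100 * (K + 1) * ((n : ℝ) + 1) ^ 3 * dist X Y ≤ δ := by
    rw [lt_div_iff₀ (by positivity)] at hXY2
    linarith
  have hd0 : 0 ≤ dist X Y := dist_nonneg
  exact ⟨(norm_sub_le_of_bounds_local hC h1 hR0 hM₁ hM₂ hX hY).trans
      ((mul_le_mul_of_nonneg_right hp4 hd0).trans hL),
    (norm_spaceDeriv_sub_le_of_bounds_local hC hR0 hM₁ hM₂ hX hY).trans
      ((mul_le_mul_of_nonneg_right hp5 hd0).trans hL), (hD2 X hX Y hY).trans hKd,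
    (hT X hX Y hY).trans hKd⟩

/-- **The blow-up contradiction on expanding domains.**  As `blowUp_core`, but the `k`-th
function is only assumed regular, `α`-Hölder (constant `K`) and an approximate caloric function
on the ball `B(0, Rₖ)` with `Rₖ → ∞`, and the size condition at `ξₖ` is `≥ θ > 0`. [folklore] -/
theorem blowUp_core_local {α : ℝ≥0} (hα0 : 0 < α) (hα1 : α < 1) {K θ : ℝ} (hK : 0 ≤ K)
    (hθ : 0 < θ) (w : ℕ → Parabolic (EuclideanSpace ℝ (Fin m)) → F) (R : ℕ → ℝ)
    (hR : Tendsto R atTop atTop)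
    (hC : ∀ k, IsC21On (w k) (ball (0 : Parabolic (EuclideanSpace ℝ (Fin m))) (R k)))
    (hD2 : ∀ k, ∀ X ∈ ball (0 : Parabolic (EuclideanSpace ℝ (Fin m))) (R k),
      ∀ Y ∈ ball (0 : Parabolic (EuclideanSpace ℝ (Fin m))) (R k),
      ‖spaceDeriv (spaceDeriv (w k)) X - spaceDeriv (spaceDeriv (w k)) Y‖ ≤
        K * dist X Y ^ (α : ℝ))
    (hT : ∀ k, ∀ X ∈ ball (0 : Parabolic (EuclideanSpace ℝ (Fin m))) (R k),
      ∀ Y ∈ ball (0 : Parabolic (EuclideanSpace ℝ (Fin m))) (R k),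
      ‖timeDeriv (w k) X - timeDeriv (w k) Y‖ ≤ K * dist X Y ^ (α : ℝ))
    (h0 : ∀ k, w k 0 = 0) (h1 : ∀ k, spaceDeriv (w k) 0 = 0)
    (h2 : ∀ k, spaceDeriv (spaceDeriv (w k)) 0 = 0) (h3 : ∀ k, timeDeriv (w k) 0 = 0)
    (ε : ℕ → ℝ) (hε : Tendsto ε atTop (𝓝 0))
    (hH : ∀ k, ∀ Z ∈ ball (0 : Parabolic (EuclideanSpace ℝ (Fin m))) (R k),
      ‖timeDeriv (w k) Z - ∑ i, spaceDeriv (spaceDeriv (w k)) Z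
        (stdOrthonormalBasis ℝ (EuclideanSpace ℝ (Fin m)) i)
        (stdOrthonormalBasis ℝ (EuclideanSpace ℝ (Fin m)) i)‖ ≤ ε k * dist Z 0 ^ (α : ℝ))
    (ξ : ℕ → Parabolic (EuclideanSpace ℝ (Fin m))) (hξ : ∀ k, dist (ξ k) 0 = 1)
    (hbig : ∀ k, θ ≤ max ‖spaceDeriv (spaceDeriv (w k)) (ξ k)‖ ‖timeDeriv (w k) (ξ k)‖) :
    False := by
  set b := stdOrthonormalBasis ℝ (EuclideanSpace ℝ (Fin m)) with hb
  -- Step 1: a subsequence along which `ξₖ → ξ₀`, `d(ξ₀, 0) = 1`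
  obtain ⟨ξ₀, -, ψ, hψ, hξlim⟩ := (isCompact_closedBall (0 : Parabolic (EuclideanSpace ℝ
    (Fin m))) 1).tendsto_subseq (x := ξ) fun k => mem_closedBall.2 (hξ k).le
  have hξ₀ : dist ξ₀ 0 = 1 :=
    mem_sphere.1 (isClosed_sphere.mem_of_tendsto hξlim
      (Eventually.of_forall fun k => mem_sphere.2 (hξ _)))
  have hRψ : Tendsto (fun i => R (ψ i)) atTop atTop := hR.comp hψ.tendsto_atTop
  -- growth of the jets on `B(0, R k)`: `‖D² wₖ Z‖, ‖∂ₜ wₖ Z‖ ≤ K d(Z, 0)^α`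
  have hgrow : ∀ k, ∀ Z ∈ ball (0 : Parabolic (EuclideanSpace ℝ (Fin m))) (R k),
      ‖spaceDeriv (spaceDeriv (w k)) Z‖ ≤ K * (1 + dist Z 0) ∧
        ‖timeDeriv (w k) Z‖ ≤ K * (1 + dist Z 0) := by
    intro k Z hZ
    have hR0 : 0 < R k := lt_of_le_of_lt dist_nonneg (mem_ball.1 hZ)
    have h0mem : (0 : Parabolic (EuclideanSpace ℝ (Fin m))) ∈ ball (0 : Parabolic
        (EuclideanSpace ℝ (Fin m))) (R k) := mem_ball_self hR0
    have hd : dist Z 0 ^ (α : ℝ) ≤ 1 + dist Z 0 := rpow_le_one_add dist_nonneg α.2 hα1.le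
    constructor
    · have h := hD2 k Z hZ 0 h0mem
      rw [h2, sub_zero] at h
      exact h.trans (mul_le_mul_of_nonneg_left hd hK)
    · have h := hT k Z hZ 0 h0mem
      rw [h3, sub_zero] at h
      exact h.trans (mul_le_mul_of_nonneg_left hd hK)
  -- Step 2: Arzelà–Ascoli on all balls (eventual form) for `w ∘ ψ`
  have hN : ∀ n : ℕ, ∃ N₀ : ℕ, ∀ i, N₀ ≤ i → 3 * ((n : ℝ) + 1) < R (ψ i) := fun n => by
    obtain ⟨N₀, hN₀⟩ := eventually_atTop.1 (hRψ.eventually_gt_atTop (3 * ((n : ℝ) + 1)))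
    exact ⟨N₀, hN₀⟩
  obtain ⟨φ, hφ, v, V, V2, Zt, hvc, hVc, hV2c, hZtc, hconv⟩ :=
    exists_subseq_jets_tendstoUniformlyOn_forall_ball_of_eventually (fun k => w (ψ k)) fun n => by
      obtain ⟨N₀, hN₀⟩ := hN n
      have hsub : ∀ i, N₀ ≤ i → ball (0 : Parabolic (EuclideanSpace ℝ (Fin m)))
          (3 * ((n : ℝ) + 1)) ⊆ ball 0 (R (ψ i)) := fun i hi => ball_subset_ball (hN₀ i hi).le
      have hC' : ∀ i, N₀ ≤ i → IsC21On (w (ψ i)) (ball (0 : Parabolic (EuclideanSpace ℝ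
          (Fin m))) (3 * ((n : ℝ) + 1))) := fun i hi => (hC _).mono (hsub i hi)
      have hM : ∀ i, N₀ ≤ i → ∀ Z ∈ ball (0 : Parabolic (EuclideanSpace ℝ (Fin m)))
          (3 * ((n : ℝ) + 1)), ‖timeDeriv (w (ψ i)) Z‖ ≤ K * (1 + 3 * ((n : ℝ) + 1)) ∧
            ‖spaceDeriv (spaceDeriv (w (ψ i))) Z‖ ≤ K * (1 + 3 * ((n : ℝ) + 1)) := by
        intro i hi Z hZ
        obtain ⟨hA, hB⟩ := hgrow (ψ i) Z (hsub i hi hZ)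
        have hd : dist Z 0 < 3 * ((n : ℝ) + 1) := mem_ball.1 hZ
        exact ⟨hB.trans (mul_le_mul_of_nonneg_left (by linarith) hK),
          hA.trans (mul_le_mul_of_nonneg_left (by linarith) hK)⟩
      have hsub1 : ∀ i, N₀ ≤ i → ball (0 : Parabolic (EuclideanSpace ℝ (Fin m)))
          ((n : ℝ) + 1) ⊆ ball 0 (R (ψ i)) := fun i hi =>
        (ball_subset_ball (by linarith)).trans (hsub i hi)
      refine ⟨N₀, ⟨100 * (K + 1) * ((n : ℝ) + 1) ^ 3, fun i hi X hX =>
        jets_bound_of_normalized_local hK n (hC' i hi) (h0 _) (h1 _) (fun Z hZ => (hM i hi Z hZ).1)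
          (fun Z hZ => (hM i hi Z hZ).2) hX⟩, fun δ hδ => ?_⟩
      refine ⟨min ((δ / (K + 1)) ^ ((α : ℝ)⁻¹)) (δ / (100 * (K + 1) * ((n : ℝ) + 1) ^ 3)),
        lt_min (Real.rpow_pos_of_pos (div_pos hδ (by linarith)) _) (by positivity),
        fun i hi X hX Y hY hXY => ?_⟩
      exact jets_modulus_of_normalized_local hα0 hK n (hC' i hi) (h1 _)
        (fun Z hZ => (hM i hi Z hZ).1) (fun Z hZ => (hM i hi Z hZ).2)
        (fun X hX Y hY => hD2 _ X (hsub1 i hi hX) Y (hsub1 i hi hY))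
        (fun X hX Y hY => hT _ X (hsub1 i hi hX) Y (hsub1 i hi hY)) hδ hX hY hXY
  -- Step 3: identification of the limits
  have hRφ : Tendsto (fun i => R (ψ (φ i))) atTop atTop := hRψ.comp hφ.tendsto_atTop
  have hevmem : ∀ X : Parabolic (EuclideanSpace ℝ (Fin m)), ∀ᶠ i in atTop,
      X ∈ ball (0 : Parabolic (EuclideanSpace ℝ (Fin m))) (R (ψ (φ i))) := fun X => by
    filter_upwards [hRφ.eventually_gt_atTop (dist X 0)] with i hi using mem_ball.2 hi
  have hCev : ∀ n : ℕ, ∃ N₀ : ℕ, ∀ i, N₀ ≤ i → IsC21On (w (ψ (φ i)))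
      (ball (0 : Parabolic (EuclideanSpace ℝ (Fin m))) ((n : ℝ) + 1)) := fun n => by
    obtain ⟨N₀, hN₀⟩ := eventually_atTop.1 (hRφ.eventually_gt_atTop ((n : ℝ) + 1))
    exact ⟨N₀, fun i hi => (hC _).mono (ball_subset_ball (hN₀ i hi).le)⟩
  obtain ⟨hvC, hsd, hsd2, htd⟩ := isC21On_univ_of_jets_tendsto_of_eventually
    (u := fun i => w (ψ (φ i))) hCev hVc hZtc
    (fun n => (hconv n).1) (fun n => (hconv n).2.1) (fun n => (hconv n).2.2.1)
    (fun n => (hconv n).2.2.2)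
  have hlimD2 : ∀ X, Tendsto (fun i => spaceDeriv (spaceDeriv (w (ψ (φ i)))) X) atTop
      (𝓝 (V2 X)) := fun X => tendsto_of_forall_ball (fun n => (hconv n).2.2.1) X
  have hlimT : ∀ X, Tendsto (fun i => timeDeriv (w (ψ (φ i))) X) atTop (𝓝 (Zt X)) :=
    fun X => tendsto_of_forall_ball (fun n => (hconv n).2.2.2) X
  -- (a) the limits are `α`-Hölder with constant `K`
  have hV2H : ∀ X Y, ‖V2 X - V2 Y‖ ≤ K * dist X Y ^ (α : ℝ) := fun X Y => by
    refine le_of_tendsto ((hlimD2 X).sub (hlimD2 Y)).norm ?_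
    filter_upwards [hevmem X, hevmem Y] with i hX hY using hD2 _ X hX Y hY
  have hZtH : ∀ X Y, ‖Zt X - Zt Y‖ ≤ K * dist X Y ^ (α : ℝ) := fun X Y => by
    refine le_of_tendsto ((hlimT X).sub (hlimT Y)).norm ?_
    filter_upwards [hevmem X, hevmem Y] with i hX hY using hT _ X hX Y hY
  -- (b) the values at `0`
  have hV20 : V2 0 = 0 :=
    tendsto_nhds_unique (hlimD2 0) (by simp only [h2]; exact tendsto_const_nhds)
  have hZt0 : Zt 0 = 0 :=
    tendsto_nhds_unique (hlimT 0) (by simp only [h3]; exact tendsto_const_nhds)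
  -- (c) the heat equation for the limit
  have hheat : ∀ X, Zt X = ∑ i, V2 X (b i) (b i) := by
    intro X
    have hsum : Tendsto (fun i => ∑ j, spaceDeriv (spaceDeriv (w (ψ (φ i)))) X (b j) (b j)) atTop
        (𝓝 (∑ j, V2 X (b j) (b j))) := by
      refine tendsto_finsetSum _ fun j _ => ?_
      have hcont : Continuous
          fun L : EuclideanSpace ℝ (Fin m) →L[ℝ] EuclideanSpace ℝ (Fin m) →L[ℝ] F =>
            L (b j) (b j) :=
        (ContinuousLinearMap.apply ℝ F (b j)).continuous.comp
          (ContinuousLinearMap.apply ℝ (EuclideanSpace ℝ (Fin m) →L[ℝ] F) (b j)).continuous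
      exact (hcont.tendsto _).comp (hlimD2 X)
    have hdiff : Tendsto (fun i => timeDeriv (w (ψ (φ i))) X -
        ∑ j, spaceDeriv (spaceDeriv (w (ψ (φ i)))) X (b j) (b j)) atTop (𝓝 0) := by
      refine squeeze_zero_norm' (a := fun i => ε (ψ (φ i)) * dist X 0 ^ (α : ℝ)) ?_ ?_
      · filter_upwards [hevmem X] with i hX using hH _ X hX
      · have h := (hε.comp ((hψ.comp hφ).tendsto_atTop)).mul_const (dist X 0 ^ (α : ℝ))
        rwa [zero_mul] at h
    exact sub_eq_zero.1 (tendsto_nhds_unique ((hlimT X).sub hsum) hdiff)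
  -- (d) the values at `ξ₀`
  have hξmem : ∀ k, ξ k ∈ ball (0 : Parabolic (EuclideanSpace ℝ (Fin m))) ((1 : ℕ) + 1) :=
    fun k => mem_ball.2 (by rw [hξ k]; norm_num)
  have hξlim' : Tendsto (fun i => ξ (ψ (φ i))) atTop
      (𝓝[ball (0 : Parabolic (EuclideanSpace ℝ (Fin m))) ((1 : ℕ) + 1)] ξ₀) :=
    tendsto_nhdsWithin_iff.2 ⟨hξlim.comp hφ.tendsto_atTop, Eventually.of_forall fun i => hξmem _⟩
  have haD2 : Tendsto (fun i => spaceDeriv (spaceDeriv (w (ψ (φ i)))) (ξ (ψ (φ i)))) atTop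
      (𝓝 (V2 ξ₀)) :=
    ((hconv 1).2.2.1).tendsto_comp hV2c.continuousAt.continuousWithinAt hξlim'
  have haT : Tendsto (fun i => timeDeriv (w (ψ (φ i))) (ξ (ψ (φ i)))) atTop (𝓝 (Zt ξ₀)) :=
    ((hconv 1).2.2.2).tendsto_comp hZtc.continuousAt.continuousWithinAt hξlim'
  have hbig0 : θ ≤ max ‖V2 ξ₀‖ ‖Zt ξ₀‖ :=
    ge_of_tendsto (haD2.norm.max haT.norm) (Eventually.of_forall fun i => hbig _)
  -- Step 4: the Liouville theorem for the limit, and the contradiction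
  obtain ⟨hc2, hct⟩ := jets_const_of_heat_limit_of_le hα1 hK hvC hvc hVc hV2c hZtc hsd hsd2 htd
    hV2H hZtH hheat
  have e2 : V2 ξ₀ = 0 := (hc2 ξ₀).trans hV20
  have et : Zt ξ₀ = 0 := (hct ξ₀).trans hZt0
  rw [e2, et] at hbig0
  have h00 : ‖(0 : EuclideanSpace ℝ (Fin m) →L[ℝ] EuclideanSpace ℝ (Fin m) →L[ℝ] F)‖ = 0 :=
    ContinuousLinearMap.opNorm_zero
  rw [h00, norm_zero, max_self] at hbig0
  exact (lt_irrefl _) (hθ.trans_le hbig0)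

/-- The size bookkeeping at a violating pair: `η ρ^α < ‖gX - gY‖` and `κ ρ^α = η⁻¹` give
`1 ≤ ‖κ (gY - gX)‖`. [folklore] -/
theorem one_le_norm_smul_sub {G : Type*} [NormedAddCommGroup G] [NormedSpace ℝ G] {gX gY : G}
    {η κ ρ α : ℝ} (hη : 0 < η) (hκ0 : 0 < κ) (hκρ : κ * ρ ^ α = η⁻¹)
    (h : η * ρ ^ α < ‖gX - gY‖) : (1 : ℝ) ≤ ‖κ • (gY - gX)‖ := by
  rw [norm_smul, Real.norm_eq_abs, abs_of_pos hκ0, norm_sub_rev]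
  have h2 : κ * (η * ρ ^ α) ≤ κ * ‖gX - gY‖ := mul_le_mul_of_nonneg_left h.le hκ0.le
  have h3 : κ * (η * ρ ^ α) = 1 := by
    calc κ * (η * ρ ^ α) = (κ * ρ ^ α) * η := by ring
      _ = 1 := by rw [hκρ, inv_mul_cancel₀ hη.ne']
  linarith

omit [FiniteDimensional ℝ F] in
/-- Rescaled recentred differences `Z ↦ κ (g(X + δ_ρ Z) - g(X))` of a `g` which is `α`-Hölder with
constant `Λ` on a set containing the points `X + δ_ρ Z`, `X + δ_ρ Z'` satisfy the Hölder bound with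
constant `Λ / η` once `κ ρ^α = η⁻¹`. [folklore] -/
theorem norm_rescale_sub_le {G : Type*} [NormedAddCommGroup G] [NormedSpace ℝ G]
    {g : Parabolic (EuclideanSpace ℝ (Fin m)) → G} {Λ η κ ρ : ℝ} {α : ℝ≥0}
    (hρ0 : 0 < ρ) (hκ0 : 0 < κ) (hκρ : κ * ρ ^ (α : ℝ) = η⁻¹)
    (X Z Z' : Parabolic (EuclideanSpace ℝ (Fin m)))
    (hg : ‖g (X + dilation ρ Z) - g (X + dilation ρ Z')‖ ≤
      Λ * dist (X + dilation ρ Z) (X + dilation ρ Z') ^ (α : ℝ)) :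
    ‖κ • (g (X + dilation ρ Z) - g X) - κ • (g (X + dilation ρ Z') - g X)‖ ≤
      Λ / η * dist Z Z' ^ (α : ℝ) := by
  rw [← smul_sub, sub_sub_sub_cancel_right, norm_smul, Real.norm_eq_abs, abs_of_pos hκ0]
  rw [dist_add_dilation _ _ _ hρ0.le, Real.mul_rpow hρ0.le dist_nonneg] at hg
  calc κ * ‖g (X + dilation ρ Z) - g (X + dilation ρ Z')‖
      ≤ κ * (Λ * (ρ ^ (α : ℝ) * dist Z Z' ^ (α : ℝ))) := mul_le_mul_of_nonneg_left hg hκ0.le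
    _ = (κ * ρ ^ (α : ℝ)) * Λ * dist Z Z' ^ (α : ℝ) := by ring
    _ = Λ / η * dist Z Z' ^ (α : ℝ) := by rw [hκρ, inv_mul_eq_div]

omit [FiniteDimensional ℝ F] in
/-- **The normalized blow-up at a violating pair, local form.**  Let `u` satisfy the guard on
`B(0, r')`, with `D² u`, `∂ₜ u` `α`-Hölder (constant `Λ`) and `∂ₜ u - tr D² u` `α`-Hölder
(constant `μ`) there, and let `X, Y ∈ B(0, r)`, `r < r'`, violate the Hölder bound with constant
`η` for `D² u` or `∂ₜ u`.  Then `ρ = d(X, Y) > 0` and the recentred, dilated, rescaled,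
Taylor-normalized `w` is regular on `B(0, (r' - r)/ρ)`, where its `D²`, `∂ₜ` are `α`-Hölder with
constant `Λ/η`, its heat operator is bounded by `(μ/η) d(·, 0)^α`, and its jets have size `≥ 1`
at a point of the unit parabolic sphere. [folklore] -/
theorem exists_normalized_local {α : ℝ≥0} {r r' : ℝ} (hrr' : r < r')
    {u : Parabolic (EuclideanSpace ℝ (Fin m)) → F}
    (hu : IsC21On u (ball (0 : Parabolic (EuclideanSpace ℝ (Fin m))) r')) {Λ : ℝ}
    (hD2 : ∀ X ∈ ball (0 : Parabolic (EuclideanSpace ℝ (Fin m))) r',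
      ∀ Y ∈ ball (0 : Parabolic (EuclideanSpace ℝ (Fin m))) r',
      ‖spaceDeriv (spaceDeriv u) X - spaceDeriv (spaceDeriv u) Y‖ ≤ Λ * dist X Y ^ (α : ℝ))
    (hT : ∀ X ∈ ball (0 : Parabolic (EuclideanSpace ℝ (Fin m))) r',
      ∀ Y ∈ ball (0 : Parabolic (EuclideanSpace ℝ (Fin m))) r',
      ‖timeDeriv u X - timeDeriv u Y‖ ≤ Λ * dist X Y ^ (α : ℝ))
    {μ : ℝ}
    (hL : ∀ X ∈ ball (0 : Parabolic (EuclideanSpace ℝ (Fin m))) r',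
      ∀ Y ∈ ball (0 : Parabolic (EuclideanSpace ℝ (Fin m))) r',
      ‖(timeDeriv u X - ∑ i, spaceDeriv (spaceDeriv u) X
          (stdOrthonormalBasis ℝ (EuclideanSpace ℝ (Fin m)) i)
          (stdOrthonormalBasis ℝ (EuclideanSpace ℝ (Fin m)) i)) -
        (timeDeriv u Y - ∑ i, spaceDeriv (spaceDeriv u) Y
          (stdOrthonormalBasis ℝ (EuclideanSpace ℝ (Fin m)) i)
          (stdOrthonormalBasis ℝ (EuclideanSpace ℝ (Fin m)) i))‖ ≤ μ * dist X Y ^ (α : ℝ))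
    {η : ℝ} (hη : 0 < η) {X Y : Parabolic (EuclideanSpace ℝ (Fin m))}
    (hX : X ∈ ball (0 : Parabolic (EuclideanSpace ℝ (Fin m))) r)
    (hY : Y ∈ ball (0 : Parabolic (EuclideanSpace ℝ (Fin m))) r)
    (hviol : η * dist X Y ^ (α : ℝ) < ‖spaceDeriv (spaceDeriv u) X - spaceDeriv (spaceDeriv u) Y‖ ∨
      η * dist X Y ^ (α : ℝ) < ‖timeDeriv u X - timeDeriv u Y‖) :
    ∃ (w : Parabolic (EuclideanSpace ℝ (Fin m)) → F) (ξ : Parabolic (EuclideanSpace ℝ (Fin m))),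
      0 < dist X Y ∧
      IsC21On w (ball (0 : Parabolic (EuclideanSpace ℝ (Fin m))) ((r' - r) / dist X Y)) ∧
      (∀ Z ∈ ball (0 : Parabolic (EuclideanSpace ℝ (Fin m))) ((r' - r) / dist X Y),
        ∀ Z' ∈ ball (0 : Parabolic (EuclideanSpace ℝ (Fin m))) ((r' - r) / dist X Y),
        ‖spaceDeriv (spaceDeriv w) Z - spaceDeriv (spaceDeriv w) Z'‖ ≤
          Λ / η * dist Z Z' ^ (α : ℝ)) ∧
      (∀ Z ∈ ball (0 : Parabolic (EuclideanSpace ℝ (Fin m))) ((r' - r) / dist X Y),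
        ∀ Z' ∈ ball (0 : Parabolic (EuclideanSpace ℝ (Fin m))) ((r' - r) / dist X Y),
        ‖timeDeriv w Z - timeDeriv w Z'‖ ≤ Λ / η * dist Z Z' ^ (α : ℝ)) ∧
      w 0 = 0 ∧ spaceDeriv w 0 = 0 ∧ spaceDeriv (spaceDeriv w) 0 = 0 ∧ timeDeriv w 0 = 0 ∧
      (∀ Z ∈ ball (0 : Parabolic (EuclideanSpace ℝ (Fin m))) ((r' - r) / dist X Y),
        ‖timeDeriv w Z - ∑ i, spaceDeriv (spaceDeriv w) Z
          (stdOrthonormalBasis ℝ (EuclideanSpace ℝ (Fin m)) i)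
          (stdOrthonormalBasis ℝ (EuclideanSpace ℝ (Fin m)) i)‖ ≤ μ / η * dist Z 0 ^ (α : ℝ)) ∧
      dist ξ 0 = 1 ∧ (1 : ℝ) ≤ max ‖spaceDeriv (spaceDeriv w) ξ‖ ‖timeDeriv w ξ‖ := by
  set b := stdOrthonormalBasis ℝ (EuclideanSpace ℝ (Fin m)) with hb
  set D2 := spaceDeriv (spaceDeriv u) with hD2def
  set Tu := timeDeriv u with hTudef
  set Hu : Parabolic (EuclideanSpace ℝ (Fin m)) → F := fun X => Tu X - ∑ i, D2 X (b i) (b i)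
    with hHudef
  have hr' : r < r' := hrr'
  have hXr' : X ∈ ball (0 : Parabolic (EuclideanSpace ℝ (Fin m))) r' := ball_subset_ball hr'.le hX
  have hYr' : Y ∈ ball (0 : Parabolic (EuclideanSpace ℝ (Fin m))) r' := ball_subset_ball hr'.le hY
  -- the scale `ρ = d(X, Y) > 0`
  set ρ : ℝ := dist X Y with hρ
  have hρ0 : 0 < ρ := by
    rcases eq_or_lt_of_le (dist_nonneg : 0 ≤ dist X Y) with h | h
    · exfalso
      have hXYeq : X = Y := dist_eq_zero.1 h.symm
      rcases hviol with h' | h'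
      · rw [hXYeq, sub_self, norm_zero] at h'
        exact (lt_irrefl _) (h'.trans_le' (by positivity))
      · rw [hXYeq, sub_self, norm_zero] at h'
        exact (lt_irrefl _) (h'.trans_le' (by positivity))
    · exact h
  -- the rescaled, recentred, Taylor-normalized function
  set κ : ℝ := η⁻¹ * ρ ^ (-(α : ℝ)) with hκ
  have hκ0 : 0 < κ := by positivity
  have hκρ : κ * ρ ^ (α : ℝ) = η⁻¹ := by
    rw [hκ, mul_assoc, ← Real.rpow_add hρ0, neg_add_cancel, Real.rpow_zero, mul_one]
  obtain ⟨w, hwC, hw0, hw1, hwD2, hwT⟩ := exists_blowUp_normalization_of_isOpen hu isOpen_ball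
    hXr' ρ (κ / ρ ^ 2)
  have hcρ : κ / ρ ^ 2 * ρ ^ 2 = κ := div_mul_cancel₀ κ (by positivity)
  simp only [hcρ] at hwD2 hwT
  -- the ball `B(0, (r' - r)/ρ)` is mapped into `B(0, r')` by `A`
  have hA0 : X + dilation ρ 0 = X := by
    rw [Literature.Geometry.Riemannian.ParabolicFlow.dilation_zero', add_zero]
  have hdA : ∀ Z, dist (X + dilation ρ Z) X = ρ * dist Z 0 := fun Z => by
    have h' := dist_add_dilation X Z 0 hρ0.le
    rwa [hA0] at h'
  have hA : ∀ Z ∈ ball (0 : Parabolic (EuclideanSpace ℝ (Fin m))) ((r' - r) / ρ),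
      X + dilation ρ Z ∈ ball (0 : Parabolic (EuclideanSpace ℝ (Fin m))) r' := by
    intro Z hZ
    have hZ' : ρ * dist Z 0 < r' - r := by
      have h := mem_ball.1 hZ
      rwa [lt_div_iff₀ hρ0, mul_comm] at h
    refine mem_ball.2 ?_
    calc dist (X + dilation ρ Z) 0 ≤ dist (X + dilation ρ Z) X + dist X 0 := dist_triangle _ _ _
      _ < (r' - r) + r := by rw [hdA]; exact add_lt_add hZ' (mem_ball.1 hX)
      _ = r' := by ring
  -- the point `ξ` with `X + δ_ρ ξ = Y`
  set ξ : Parabolic (EuclideanSpace ℝ (Fin m)) := dilation ρ⁻¹ (Y - X) with hξ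
  have hAξ : X + dilation ρ ξ = Y := by
    rw [hξ, dilation_dilation, mul_inv_cancel₀ hρ0.ne', dilation_one, add_sub_cancel]
  have hξ1 : dist ξ 0 = 1 := by
    rw [hξ, ← Literature.Geometry.Riemannian.ParabolicFlow.dilation_zero' ρ⁻¹,
      dist_dilation (inv_nonneg.2 hρ0.le), ← sub_self X,
      Parabolic.dist_sub_right, dist_comm, ← hρ, inv_mul_cancel₀ hρ0.ne']
  have hξA : X + dilation ρ ξ ∈ ball (0 : Parabolic (EuclideanSpace ℝ (Fin m))) r' := by
    rw [hAξ]; exact hYr'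
  refine ⟨w, ξ, hρ0, hwC.mono fun Z hZ => hA Z hZ, fun Z hZ Z' hZ' => ?_, fun Z hZ Z' hZ' => ?_,
    hw0, hw1, ?_, ?_, fun Z hZ => ?_, hξ1, ?_⟩
  · rw [hwD2 Z (hA Z hZ), hwD2 Z' (hA Z' hZ')]
    exact norm_rescale_sub_le hρ0 hκ0 hκρ X Z Z' (hD2 _ (hA Z hZ) _ (hA Z' hZ'))
  · rw [hwT Z (hA Z hZ), hwT Z' (hA Z' hZ')]
    exact norm_rescale_sub_le hρ0 hκ0 hκρ X Z Z' (hT _ (hA Z hZ) _ (hA Z' hZ'))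
  · rw [hwD2 0 (by rw [hA0]; exact hXr'), hA0, sub_self, smul_zero]
  · rw [hwT 0 (by rw [hA0]; exact hXr'), hA0, sub_self, smul_zero]
  · -- the heat operator of `w` on the ball
    have hwH : timeDeriv w Z - ∑ i, spaceDeriv (spaceDeriv w) Z (b i) (b i) =
        κ • (Hu (X + dilation ρ Z) - Hu X) := by
      rw [hwT Z (hA Z hZ), hHudef]
      simp only [hwD2 Z (hA Z hZ), FunLike.coe_smul, Pi.smul_apply, FunLike.coe_sub, Pi.sub_apply,
        smul_sub, Finset.smul_sum, Finset.sum_sub_distrib]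
      abel
    rw [hwH, norm_smul, Real.norm_eq_abs, abs_of_pos hκ0]
    have h := hL _ (hA Z hZ) _ hXr'
    rw [hdA Z, Real.mul_rpow hρ0.le dist_nonneg] at h
    calc κ * ‖Hu (X + dilation ρ Z) - Hu X‖ ≤ κ * (μ * (ρ ^ (α : ℝ) * dist Z 0 ^ (α : ℝ))) :=
          mul_le_mul_of_nonneg_left h hκ0.le
      _ = (κ * ρ ^ (α : ℝ)) * μ * dist Z 0 ^ (α : ℝ) := by ring
      _ = μ / η * dist Z 0 ^ (α : ℝ) := by rw [hκρ, inv_mul_eq_div]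
  · -- the size at `ξ`
    rcases hviol with h | h
    · refine le_max_of_le_left ?_
      rw [hwD2 ξ hξA, hAξ]
      exact one_le_norm_smul_sub hη hκ0 hκρ h
    · refine le_max_of_le_right ?_
      rw [hwT ξ hξA, hAξ]
      exact one_le_norm_smul_sub hη hκ0 hκρ h

/-- **White's use of the interior Schauder estimate, by blow-up on expanding domains** (White 2005,
pp. 1499 and 1505, the role of Thm. 8.2 there): let `uᵢ` satisfy the regularity guard on the
parabolic ball `B(0, r')`, with `D² uᵢ`, `∂ₜ uᵢ` `α`-Hölder there with a common constant `Λ`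
(uniform `C^{2,α}` bound), `sup_{B(0,r')} (‖D² uᵢ‖ + ‖∂ₜ uᵢ‖) → 0` (`C²` convergence to `0`) and
heat operators `∂ₜ uᵢ - tr D² uᵢ` `α`-Hölder with constants `μᵢ → 0` (`L uᵢ → 0` in `C^α`).
Then for every `η > 0`, eventually `D² uᵢ` and `∂ₜ uᵢ` are `α`-Hölder with constant `η` on the
smaller ball `B(0, r)` (`C^{2,α}` convergence to `0`).  Proof: a violating pair `Xᵢ, Yᵢ ∈ B(0, r)`
has `ρᵢ = d(Xᵢ, Yᵢ) → 0` by the `C²` convergence; blowing up at `Xᵢ` by `ρᵢ`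
(`exists_normalized_local`) produces the situation excluded by `blowUp_core_local` on the balls
`B(0, (r' - r)/ρᵢ)`. [cite: White2005, Thm. 8.2 and pp. 1499, 1505] -/
theorem jets_holder_eventually_le_of_heat {α : ℝ≥0} (hα0 : 0 < α) (hα1 : α < 1) {r r' : ℝ}
    (hrr' : r < r') (u : ℕ → Parabolic (EuclideanSpace ℝ (Fin m)) → F)
    (hC : ∀ i, IsC21On (u i) (ball (0 : Parabolic (EuclideanSpace ℝ (Fin m))) r'))
    {Λ : ℝ} (hΛ : 0 ≤ Λ)
    (hD2 : ∀ i, ∀ X ∈ ball (0 : Parabolic (EuclideanSpace ℝ (Fin m))) r',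
      ∀ Y ∈ ball (0 : Parabolic (EuclideanSpace ℝ (Fin m))) r',
      ‖spaceDeriv (spaceDeriv (u i)) X - spaceDeriv (spaceDeriv (u i)) Y‖ ≤
        Λ * dist X Y ^ (α : ℝ))
    (hT : ∀ i, ∀ X ∈ ball (0 : Parabolic (EuclideanSpace ℝ (Fin m))) r',
      ∀ Y ∈ ball (0 : Parabolic (EuclideanSpace ℝ (Fin m))) r',
      ‖timeDeriv (u i) X - timeDeriv (u i) Y‖ ≤ Λ * dist X Y ^ (α : ℝ))
    (hsup : ∀ δ > (0 : ℝ), ∀ᶠ i in atTop, ∀ X ∈ ball (0 : Parabolic (EuclideanSpace ℝ (Fin m))) r',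
      ‖spaceDeriv (spaceDeriv (u i)) X‖ ≤ δ ∧ ‖timeDeriv (u i) X‖ ≤ δ)
    (μ : ℕ → ℝ) (hμ : Tendsto μ atTop (𝓝 0))
    (hL : ∀ i, ∀ X ∈ ball (0 : Parabolic (EuclideanSpace ℝ (Fin m))) r',
      ∀ Y ∈ ball (0 : Parabolic (EuclideanSpace ℝ (Fin m))) r',
      ‖(timeDeriv (u i) X - ∑ j, spaceDeriv (spaceDeriv (u i)) X
          (stdOrthonormalBasis ℝ (EuclideanSpace ℝ (Fin m)) j)
          (stdOrthonormalBasis ℝ (EuclideanSpace ℝ (Fin m)) j)) -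
        (timeDeriv (u i) Y - ∑ j, spaceDeriv (spaceDeriv (u i)) Y
          (stdOrthonormalBasis ℝ (EuclideanSpace ℝ (Fin m)) j)
          (stdOrthonormalBasis ℝ (EuclideanSpace ℝ (Fin m)) j))‖ ≤ μ i * dist X Y ^ (α : ℝ))
    {η : ℝ} (hη : 0 < η) :
    ∀ᶠ i in atTop, ∀ X ∈ ball (0 : Parabolic (EuclideanSpace ℝ (Fin m))) r,
      ∀ Y ∈ ball (0 : Parabolic (EuclideanSpace ℝ (Fin m))) r,
      ‖spaceDeriv (spaceDeriv (u i)) X - spaceDeriv (spaceDeriv (u i)) Y‖ ≤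
          η * dist X Y ^ (α : ℝ) ∧
        ‖timeDeriv (u i) X - timeDeriv (u i) Y‖ ≤ η * dist X Y ^ (α : ℝ) := by
  by_contra hcon
  rw [not_eventually] at hcon
  obtain ⟨σ, hσ, hbad⟩ := extraction_of_frequently_atTop hcon
  -- violating pairs
  have hpair : ∀ k, ∃ X ∈ ball (0 : Parabolic (EuclideanSpace ℝ (Fin m))) r,
      ∃ Y ∈ ball (0 : Parabolic (EuclideanSpace ℝ (Fin m))) r,
      η * dist X Y ^ (α : ℝ) <
          ‖spaceDeriv (spaceDeriv (u (σ k))) X - spaceDeriv (spaceDeriv (u (σ k))) Y‖ ∨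
        η * dist X Y ^ (α : ℝ) < ‖timeDeriv (u (σ k)) X - timeDeriv (u (σ k)) Y‖ := by
    intro k
    have h := hbad k
    push Not at h
    obtain ⟨X, hX, Y, hY, hXY⟩ := h
    by_cases hle : ‖spaceDeriv (spaceDeriv (u (σ k))) X - spaceDeriv (spaceDeriv (u (σ k))) Y‖ ≤
        η * dist X Y ^ (α : ℝ)
    · exact ⟨X, hX, Y, hY, Or.inr (hXY hle)⟩
    · exact ⟨X, hX, Y, hY, Or.inl (lt_of_not_ge hle)⟩
  choose Xk hXk Yk hYk hviol using hpair
  -- the blow-ups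
  choose w ξ hρ0 hwC hwD2 hwT hw0 hw1 hw2 hw3 hwH hξ1 hbig using fun k =>
    exists_normalized_local hrr' (hC (σ k)) (hD2 (σ k)) (hT (σ k)) (hL (σ k)) hη (hXk k)
      (hYk k) (hviol k)
  set ρ : ℕ → ℝ := fun k => dist (Xk k) (Yk k) with hρ
  -- the scales tend to `0` by the `C²` convergence
  have hρlim : Tendsto ρ atTop (𝓝 0) := by
    refine Metric.tendsto_nhds.2 fun e he => ?_
    have hη' : 0 < η * e ^ (α : ℝ) / 4 := by positivity
    have hev := hσ.tendsto_atTop.eventually (hsup _ hη')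
    filter_upwards [hev] with k hk
    rw [Real.dist_eq, sub_zero, abs_of_pos (hρ0 k)]
    have hXr' : Xk k ∈ ball (0 : Parabolic (EuclideanSpace ℝ (Fin m))) r' :=
      ball_subset_ball hrr'.le (hXk k)
    have hYr' : Yk k ∈ ball (0 : Parabolic (EuclideanSpace ℝ (Fin m))) r' :=
      ball_subset_ball hrr'.le (hYk k)
    have hsmall : η * ρ k ^ (α : ℝ) < η * e ^ (α : ℝ) := by
      rcases hviol k with h | h
      · have h2 := norm_sub_le (spaceDeriv (spaceDeriv (u (σ k))) (Xk k))
          (spaceDeriv (spaceDeriv (u (σ k))) (Yk k))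
        linarith [(hk _ hXr').1, (hk _ hYr').1]
      · have h2 := norm_sub_le (timeDeriv (u (σ k)) (Xk k)) (timeDeriv (u (σ k)) (Yk k))
        linarith [(hk _ hXr').2, (hk _ hYr').2]
    have h3 : ρ k ^ (α : ℝ) < e ^ (α : ℝ) := lt_of_mul_lt_mul_left hsmall hη.le
    exact (Real.rpow_lt_rpow_iff (hρ0 k).le he.le (NNReal.coe_pos.2 hα0)).1 h3
  -- hence the radii `(r' - r)/ρₖ` tend to infinity
  have hRlim : Tendsto (fun k => (r' - r) / ρ k) atTop atTop := by
    have h1 : Tendsto ρ atTop (𝓝[>] 0) :=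
      tendsto_nhdsWithin_iff.2 ⟨hρlim, Eventually.of_forall fun k => hρ0 k⟩
    have h2 : Tendsto (fun k => (ρ k)⁻¹) atTop atTop := tendsto_inv_nhdsGT_zero.comp h1
    simpa [div_eq_mul_inv] using h2.const_mul_atTop (sub_pos.2 hrr')
  -- the contradiction
  exact blowUp_core_local hα0 hα1 (K := Λ / η) (θ := 1) (div_nonneg hΛ hη.le) one_pos w
    (fun k => (r' - r) / ρ k) hRlim hwC hwD2 hwT hw0 hw1 hw2 hw3 (fun k => μ (σ k) / η)
    (by simpa using (hμ.comp hσ.tendsto_atTop).div_const η) hwH ξ hξ1 hbig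

end Local

end Literature.Analysis.PDE
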